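import Literature.Analysis.FluidPDE.SerrinEnstrophyGronwall
import Literature.Analysis.FluidPDE.TaoQuantitativeNonlinearEnergy
import Literature.Analysis.FluidPDE.NSVorticityBKMContinuation
import HarnessLib

/-!
# Beirão da Veiga's enstrophy inequality `‖∇u(t)‖² ≤ ‖∇u(0)‖² exp(C ν^{1-q} ∫₀ᵗ ‖∇u‖_{L^r}^q)`,
# `2/q + 3/r = 2`, for smooth solutions on `ℝ³`

search for candidate a priori estimates; no regularity claim (cell `pub-nsfunc`, literature seat:
this file formalises the PUBLISHED a-priori estimate behind Beirão da Veiga's criterion; nothing new).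

Analysis/FluidPDE proof file (theorems only: no definition, no named fact, no `sorry`). It is the
a-priori estimate of the discharge of the named fact
`Literature.Analysis.FluidPDE.BeiraoDaVeiga1995_gradientCriterion` (`GradientRegularityCriteria.lean`;
H. Beirão da Veiga, Chinese Ann. Math. Ser. B 16 (1995) 407–412; as restated by Berselli–Galdi,
Proc. Amer. Math. Soc. 130 (2002), (1.3) p. 3586: "if `∇u ∈ L^r(0,T;L^s(ℝⁿ))` with
`2/r + n/s = 2`, for `s > n/2`, then weak solutions are of class `C^∞(ℝⁿ × (0,T])`; see Beirão da
Veiga [2] and Galdi [10]; see also Berselli [8] for a simple proof when `n = 3`"; Lemarié-Rieusset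
2016, §11.5 p. 329), written as the exact twin of the tree's Serrin file
`SerrinEnstrophyGronwall.lean` (Lemarié-Rieusset 2016, Thm. 11.2, (11.9)–(11.11)): the energy
method for `‖∇u‖²₂` with the trilinear term estimated by `‖∇u‖_{L^r}` instead of `‖u‖_{L^r}`,

  `d/dt ‖∇u‖²₂ ≤ C ν^{1-q} ‖∇u‖_{L^r}^q ‖∇u‖²₂`,  `2/q + 3/r = 2`, `3/2 < r < ∞`, `1 < q < ∞`,

followed by Grönwall's lemma on a closed slab `[0, T] × ℝ³` in the `L²`-Sobolev class of Tao's
smooth `H¹` theory (`u, ∂ₜu, p ∈ L^∞_t H^k_x`, the hypotheses of `serrin_enstrophy_le_mul_exp`).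

## The computation (one time slice, `v = u(t)`, `W = ∂ₜu(t)`, `vⱼ = ∂ⱼv`)

1. `∫ Σᵢ ⟪∂ᵢv, ∂ᵢW⟫ = -∫ ⟪Δv, W⟫ = -ν‖Δv‖²₂ + ∫ ⟪Δv, (v·∇)v⟫ + ∫ ⟪Δv, ∇p⟫`, the pressure term
   vanishing since `div Δv = 0` (verbatim as in the Serrin file);
2. the trilinear identity `∫ ⟪Δv, (v·∇)v⟫ = -Σⱼ ∫ ⟪∂ⱼv, Dv ∂ⱼv⟫` (one integration by parts,
   `∂ⱼ((v·∇)v) = Dv ∂ⱼv + (v·∇)∂ⱼv`, and the transport term `∫⟪∂ⱼv, (v·∇)∂ⱼv⟫ = 0` by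
   `div v = 0`) — in coordinates `∫ Δu·(u·∇)u = -Σ ∂ₖuⱼ ∂ⱼuᵢ ∂ₖuᵢ`
   (`integral_inner_laplacian_convect_eq_neg_sum`); hence `∫⟪Δv, (v·∇)v⟫ ≤ Σⱼ ∫ ‖Dv‖ ‖vⱼ‖²`;
3. for each `j` (`θ = 1 - 3/(2r)`, `m = 2r/(r-1) ∈ (2, 6)`): Hölder `(r, m/2)`,
   `∫ ‖Dv‖ ‖vⱼ‖² ≤ ‖Dv‖_r ‖vⱼ‖_m²`, Lebesgue interpolation `‖vⱼ‖_m ≤ ‖vⱼ‖₂^θ ‖vⱼ‖₆^{1-θ}`, the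
   Sobolev inequality `‖vⱼ‖₆ ≤ K ‖Dvⱼ‖₂` and `‖Dvⱼ‖²₂ ≤ Rⱼ := Σᵢ ‖∂ᵢvⱼ‖²₂`, so that
   `∫ ‖Dv‖ ‖vⱼ‖² ≤ ‖Dv‖_r aⱼ^θ (K² Rⱼ)^{1-θ}`, `aⱼ = ‖vⱼ‖²₂`
   (`integral_norm_fderiv_mul_sq_norm_fderiv_apply_le`);
4. Young's inequality with the weights `(1-θ, θ)` absorbs `Rⱼ^{1-θ}` into half the dissipation:
   `‖Dv‖_r aⱼ^θ (K² Rⱼ)^{1-θ} ≤ (ν/2) Rⱼ + C(θ) ν^{1-1/θ} ‖Dv‖_r^{1/θ} aⱼ` (`bdv_absorb_component`,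
   the tree's `mul_rpow_mul_rpow_le_absorb`), with `q = 1/θ = 2r/(2r-3)`; summing over `j` and using
   the Hessian–Laplacian identity `Σⱼ Rⱼ = ‖Δv‖²₂` (`EnstrophySplitting.lean`):
   `∫ Σᵢ ⟪∂ᵢv, ∂ᵢW⟫ ≤ C ν^{1-q} ‖Dv‖_r^q ∫ |∇v|²`
   (`integral_sum_inner_fderiv_le_of_momentum_of_gradient_eLpNorm`);
5. on the slab, the balance `IsSmoothSpaceTimeOn.enstrophy_balance` and the integral form of
   Grönwall's lemma with an `L¹` kernel (`lintegral_gronwall_le`) conclude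
   (`bdv_enstrophy_le_mul_exp`, packaged with an existential constant in `bdv_enstrophy_bound`).
   The slice bound is only needed at almost every time (hypothesis: `∇u(t) ∈ L^r` for a.e. `t`,
   which is what membership in the mixed class `L^q(0,T; L^r)` provides).

The constant is explicit: `C(θ) = θ (2(1-θ))^{(1-θ)/θ} K^{2(1-θ)/θ}`, `K` the Sobolev constant of
`‖w‖_{L⁶} ≤ K‖Dw‖_{L²}` (Mathlib `SNormLESNormFDerivOfEqConst`), and the bound on the slab carries
`2 C(θ)`. No constant is printed in the sources (the criterion is qualitative); the exponent
relation `2/q + 3/r = 2` is exactly Young's conjugacy in step 4. The `L^r` norm of the gradient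
is that of `x ↦ Du(t)(x)` in the operator norm (the hypothesis shape of the named fact).

## Mathlib / tree search

All tools are the tree's Serrin-programme lemmas (cited in place): Grönwall
`lintegral_gronwall_le`, Young `mul_rpow_mul_rpow_le_absorb`, interpolation
`lintegral_rpow_interpolate` (`LerayHopfH1Test.lean`), Sobolev `H¹ ⊂ L⁶`
`eLpNorm_six_le_eLpNorm_fderiv_two` (`SobolevWholeSpace.lean`), integration by parts
`integral_sum_inner_fderiv_fderiv_eq_neg_integral_inner_laplacian` and the pressure identity
`integral_inner_gradient_eq_zero_of_isDivFree_R3` (`EnstrophyGronwall.lean`), the Hessian–Laplacian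
identity `sum_sum_integral_sq_norm_fderiv_fderiv_eq_integral_sq_norm_laplacian`
(`EnstrophySplitting.lean`), the transport identity `integral_inner_convect_transport_eq_zero`
(`TaoQuantitativeNonlinearEnergy.lean`), the `L^∞` bounds of the Tao class
`linfty_bound_of_hasBoundedSobolevNormsOn_holds` and (for `Du`)
`exists_forall_norm_fderiv_le_of_hasBoundedSobolevNormsOn` (`NSVorticityBKMContinuation.lean`), the
balance `IsSmoothSpaceTimeOn.enstrophy_balance`.
Mathlib: `ENNReal.lintegral_mul_le_Lp_mul_Lq`, `fderiv_clm_apply`. `lean search 'BeiraoDaVeiga|bdv_'`: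
only the named fact and the torus criterion `TorusNSBeiraoDaVeigaCriterion.lean` (classical
continuation form on `T³`, a different setting) — no `ℝ³` slab estimate before this file.

## References

* H. Beirão da Veiga, *A new regularity class for the Navier–Stokes equations in ℝⁿ*, Chinese
  Ann. Math. Ser. B 16 (1995) 407–412. [BeiraoDaVeiga1995]
* L. C. Berselli, G. P. Galdi, *Regularity criteria involving the pressure for the weak solutions
  to the Navier–Stokes equations*, Proc. Amer. Math. Soc. 130 (2002) 3585–3595, (1.3) p. 3586
  (held: paper:doi-10-1090-s0002-9939-02-06697-2, PDF p. 2). [BerselliGaldi2002]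
* P. G. Lemarié-Rieusset, *The Navier–Stokes Problem in the 21st Century*, CRC Press (2016),
  Thm. 11.2 with (11.9)–(11.11) and §11.5, list p. 329 (PDF p. 353). [LemarieRieusset2016]
-/

noncomputable section

open MeasureTheory Set Function Filter Topology InnerProductSpace
open scoped ENNReal NNReal ContDiff RealInnerProductSpace Laplacian

namespace Literature.Analysis.FluidPDE

section Young

/-- **Young absorption for the Beirão da Veiga slice bound**: for `0 < θ < 1`, `ν > 0` and
`N, K, a, R ≥ 0`, if `P ≤ N a^θ (K² R)^{1-θ}` then
`P ≤ (ν/2) R + θ (2(1-θ))^{(1-θ)/θ} ν^{-(1-θ)/θ} (N K^{2(1-θ)})^{1/θ} a`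
(`mul_rpow_mul_rpow_le_absorb` with the weight `N K^{2(1-θ)}`). [folklore] -/
private theorem bdv_absorb_component {θ ν N K P a R : ℝ} (hθ0 : 0 < θ) (hθ1 : θ < 1) (hν : 0 < ν)
    (hN : 0 ≤ N) (hK : 0 ≤ K) (ha : 0 ≤ a) (hR : 0 ≤ R)
    (hP : P ≤ N * a ^ θ * (K ^ 2 * R) ^ (1 - θ)) :
    P ≤ ν / 2 * R +
      θ * (2 * (1 - θ)) ^ ((1 - θ) / θ) * ν ^ (-((1 - θ) / θ)) *
        (N * K ^ (2 * (1 - θ))) ^ (1 / θ) * a := by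
  set A : ℝ := N * K ^ (2 * (1 - θ)) with hAdef
  have hA0 : 0 ≤ A := by positivity
  have h1 : P ≤ A * a ^ θ * R ^ (1 - θ) := by
    have hKR : (K ^ 2 * R) ^ (1 - θ) = K ^ (2 * (1 - θ)) * R ^ (1 - θ) := by
      rw [Real.mul_rpow (sq_nonneg _) hR, ← Real.rpow_natCast K 2, ← Real.rpow_mul hK]
      norm_num
    calc P ≤ N * a ^ θ * (K ^ 2 * R) ^ (1 - θ) := hP
      _ = A * a ^ θ * R ^ (1 - θ) := by rw [hKR, hAdef]; ring
  exact h1.trans (mul_rpow_mul_rpow_le_absorb hθ0 hθ1 hν hA0 hR ha)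

end Young

section KeyEstimate

/-- Exponent algebra of the Beirão da Veiga slice bound: for `ρ > 3/2` and `m = 2ρ/(ρ-1)`
(twice the conjugate exponent of `ρ`), `2 < m < 6`, `(ρ, m/2)` are Hölder conjugate, and the
interpolation exponents between `L²` and `L⁶` at `L^m`, multiplied by `2/m`, are `1 - 3/(2ρ)`
and `1/(2ρ)`. [folklore] -/
private theorem bdv_exponent_algebra {ρ : ℝ} (hρ : 3 / 2 < ρ) :
    let m : ℝ := 2 * ρ / (ρ - 1)
    2 < m ∧ m < 6 ∧ ρ.HolderConjugate (m / 2) ∧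
      (6 - m) / (6 - 2) * (2 / m) = 1 - 3 / (2 * ρ) ∧ (m - 2) / (6 - 2) * (2 / m) = 1 / (2 * ρ) := by
  intro m
  have hρ1 : 0 < ρ - 1 := by linarith
  have hρ0 : 0 < ρ := by linarith
  have hm : m = 2 * ρ / (ρ - 1) := rfl
  refine ⟨?_, ?_, ?_, ?_, ?_⟩
  · rw [hm, lt_div_iff₀ hρ1]; linarith
  · rw [hm, div_lt_iff₀ hρ1]; linarith
  · rw [Real.holderConjugate_iff]
    refine ⟨by linarith, ?_⟩
    rw [hm]; field_simp; ring
  · rw [hm]; field_simp; ring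
  · rw [hm]; field_simp; ring

/-- **The key estimate for one slice in the Beirão da Veiga class** (Beirão da Veiga 1995;
Berselli–Galdi 2002, (1.3): the enstrophy estimate behind `∇u ∈ L^q(0,T; L^r)`,
`2/q + 3/r = 2`). For a `C³` field `v` on `ℝ³` with `Dv, D²v ∈ L²`, `Dv` bounded (for
integrability only) and `Dv ∈ L^r`, `3/2 < r < ∞`, and the slice `vⱼ = ∂ⱼv`:
`∫ ‖Dv‖ ‖vⱼ‖² ≤ ‖Dv‖_{L^r} (∫ ‖vⱼ‖²)^{1-3/(2r)} (K² Σᵢ ∫ ‖∂ᵢvⱼ‖²)^{3/(2r)}`,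
`K` the Sobolev constant of `‖w‖_{L⁶} ≤ K‖Dw‖_{L²}`. Proof in `ℝ≥0∞`: Hölder with the conjugate
pair `(r, m/2)`, `m = 2r/(r-1)` (Mathlib `ENNReal.lintegral_mul_le_Lp_mul_Lq`), Lebesgue
interpolation of `∫ ‖vⱼ‖^m` between `2` and `6` (`lintegral_rpow_interpolate`, `2 < m < 6`),
Sobolev `‖vⱼ‖₆ ≤ K‖Dvⱼ‖₂` (`eLpNorm_six_le_eLpNorm_fderiv_two`) and `‖Dvⱼ‖²_{L²} ≤ Σᵢ ∫‖∂ᵢvⱼ‖²`.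
The twin of `integral_sq_norm_mul_norm_fderiv_apply_le` (Serrin class).
[cite: BerselliGaldi2002, (1.3) p. 3586] -/
theorem integral_norm_fderiv_mul_sq_norm_fderiv_apply_le
    {v : EuclideanSpace ℝ (Fin 3) → EuclideanSpace ℝ (Fin 3)} (hv : ContDiff ℝ 3 v)
    (hv1 : ∫⁻ x, ‖iteratedFDeriv ℝ 1 v x‖ₑ ^ 2 < ⊤) (hv2 : ∫⁻ x, ‖iteratedFDeriv ℝ 2 v x‖ₑ ^ 2 < ⊤)
    {B₁ : ℝ} (hB₁ : ∀ x, ‖fderiv ℝ v x‖ ≤ B₁) {r : ℝ≥0∞} (hr : 3 / 2 < r) (hrtop : r ≠ ⊤)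
    (hvr : eLpNorm (fderiv ℝ v) r volume < ⊤) (j : Fin 3) :
    ∫ x, ‖fderiv ℝ v x‖ * ‖fderiv ℝ v x (EuclideanSpace.basisFun (Fin 3) ℝ j)‖ ^ 2 ≤
      (eLpNorm (fderiv ℝ v) r volume).toReal *
        (∫ x, ‖fderiv ℝ v x (EuclideanSpace.basisFun (Fin 3) ℝ j)‖ ^ 2) ^ (1 - 3 / (2 * r.toReal)) *
        ((SNormLESNormFDerivOfEqConst (EuclideanSpace ℝ (Fin 3))
            (volume : Measure (EuclideanSpace ℝ (Fin 3))) 2 : ℝ) ^ 2 *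
          ∑ i, ∫ x, ‖fderiv ℝ (fun y => fderiv ℝ v y (EuclideanSpace.basisFun (Fin 3) ℝ j)) x
            (EuclideanSpace.basisFun (Fin 3) ℝ i)‖ ^ 2) ^ (3 / (2 * r.toReal)) := by
  set e := EuclideanSpace.basisFun (Fin 3) ℝ with he
  set K : ℝ≥0 := SNormLESNormFDerivOfEqConst (EuclideanSpace ℝ (Fin 3))
    (volume : Measure (EuclideanSpace ℝ (Fin 3))) 2 with hK
  -- the real exponents
  have hr0 : r ≠ 0 := (lt_trans (by norm_num) hr).ne'
  set ρ : ℝ := r.toReal with hρ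
  have hρ3 : 3 / 2 < ρ := by
    have h : ((3 / 2 : ℝ≥0∞)).toReal < r.toReal :=
      (ENNReal.toReal_lt_toReal (ENNReal.div_ne_top (by norm_num) (by norm_num)) hrtop).2 hr
    have h32 : ((3 / 2 : ℝ≥0∞)).toReal = 3 / 2 := by
      rw [ENNReal.toReal_div, ENNReal.toReal_ofNat, ENNReal.toReal_ofNat]
    rw [h32] at h
    exact h
  have hρ0 : 0 < ρ := by linarith
  obtain ⟨h2m, hm6, hconj, hexpθ, hexp1⟩ := bdv_exponent_algebra hρ3
  set m : ℝ := 2 * ρ / (ρ - 1) with hm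
  have hm0 : 0 < m := by linarith
  have hB₁0 : 0 ≤ B₁ := (norm_nonneg _).trans (hB₁ 0)
  -- the slice `vⱼ = ∂ⱼ v` and the second slices
  set vs : EuclideanSpace ℝ (Fin 3) → EuclideanSpace ℝ (Fin 3) := fun y => fderiv ℝ v y (e j) with hvs
  have hvs2 : ContDiff ℝ 2 vs := (hv.fderiv_right (m := 2) (by norm_num)).clm_apply contDiff_const
  have hvs1 : ContDiff ℝ 1 vs := hvs2.of_le (by norm_num)
  have cDv : Continuous (fderiv ℝ v) := hv.continuous_fderiv (by norm_num)
  have cvs : Continuous vs := hvs1.continuous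
  have cdvs : ∀ i, Continuous fun x => fderiv ℝ vs x (e i) := fun i =>
    (hvs1.continuous_fderiv one_ne_zero).clm_apply continuous_const
  have n_vs : ∀ x, ‖vs x‖ ≤ ‖iteratedFDeriv ℝ 1 v x‖ := fun x => norm_fderiv_apply_basisFun_le v x j
  have n_dvs : ∀ i x, ‖fderiv ℝ vs x (e i)‖ ≤ ‖iteratedFDeriv ℝ 2 v x‖ := fun i x =>
    (norm_fderiv_apply_basisFun_le vs x i).trans
      (norm_iteratedFDeriv_fderiv_apply_basisFun_le hv 1 (by norm_num) x j)
  have l2vs : ∫⁻ x, ‖vs x‖ₑ ^ 2 < ⊤ := lintegral_enorm_sq_lt_top_of_norm_le n_vs hv1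
  have l2dvs : ∀ i, ∫⁻ x, ‖fderiv ℝ vs x (e i)‖ₑ ^ 2 < ⊤ := fun i =>
    lintegral_enorm_sq_lt_top_of_norm_le (n_dvs i) hv2
  -- the real quantities `a = ∫ ‖vⱼ‖²`, `R = Σᵢ ∫ ‖∂ᵢvⱼ‖²`, `P = ∫ ‖Dv‖ ‖vⱼ‖²`
  have i_a : Integrable (fun x => ‖vs x‖ ^ 2) volume :=
    FluidPDE.integrable_sq_norm_of_lintegral_lt_top cvs l2vs
  have i_dd : ∀ i, Integrable (fun x => ‖fderiv ℝ vs x (e i)‖ ^ 2) volume := fun i =>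
    FluidPDE.integrable_sq_norm_of_lintegral_lt_top (cdvs i) (l2dvs i)
  set a : ℝ := ∫ x, ‖vs x‖ ^ 2 with ha
  set R : ℝ := ∑ i, ∫ x, ‖fderiv ℝ vs x (e i)‖ ^ 2 with hR
  have ha0 : 0 ≤ a := integral_nonneg fun x => sq_nonneg _
  have hR0 : 0 ≤ R := Finset.sum_nonneg fun i _ => integral_nonneg fun x => sq_nonneg _
  set g : EuclideanSpace ℝ (Fin 3) → ℝ := fun x => ‖fderiv ℝ v x‖ * ‖vs x‖ ^ 2 with hg
  have hg0 : ∀ x, 0 ≤ g x := fun x => mul_nonneg (norm_nonneg _) (sq_nonneg _)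
  have hgm : AEStronglyMeasurable g volume := (cDv.norm.mul (cvs.norm.pow 2)).aestronglyMeasurable
  have i_g : Integrable g volume := by
    have hdom : Integrable (fun x => B₁ * ‖vs x‖ ^ 2) volume := i_a.const_mul _
    refine hdom.mono' hgm (Eventually.of_forall fun x => ?_)
    rw [Real.norm_of_nonneg (hg0 x), hg]
    exact mul_le_mul_of_nonneg_right (hB₁ x) (sq_nonneg _)
  -- `ℝ≥0∞` versions
  have hA : ENNReal.ofReal a = ∫⁻ x, ‖vs x‖ₑ ^ (2 : ℝ) := by
    rw [ha, ofReal_integral_eq_lintegral_ofReal i_a (Eventually.of_forall fun x => sq_nonneg _)]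
    refine lintegral_congr fun x => ?_
    rw [← ofReal_norm, ENNReal.ofReal_rpow_of_nonneg (norm_nonneg _) (by norm_num), Real.rpow_two]
  have hD : eLpNorm (fderiv ℝ vs) 2 volume ^ 2 ≤ ENNReal.ofReal R := by
    rw [← lintegral_enorm_sq_eq_eLpNorm_two_sq, hR, ← integral_finsetSum _ fun i _ => i_dd i,
      ofReal_integral_eq_lintegral_ofReal (integrable_finsetSum _ fun i _ => i_dd i)
        (Eventually.of_forall fun x => Finset.sum_nonneg fun i _ => sq_nonneg _)]
    refine lintegral_mono fun x => ?_
    rw [← ofReal_norm, ← ENNReal.ofReal_pow (norm_nonneg _)]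
    exact ENNReal.ofReal_le_ofReal (FluidPDE.sq_opNorm_le_sum_sq_norm_apply e (fderiv ℝ vs x))
  have hP : ENNReal.ofReal (∫ x, g x) = ∫⁻ x, ‖fderiv ℝ v x‖ₑ * ‖vs x‖ₑ ^ (2 : ℝ) := by
    rw [ofReal_integral_eq_lintegral_ofReal i_g (Eventually.of_forall hg0)]
    refine lintegral_congr fun x => ?_
    rw [hg]
    dsimp only
    rw [ENNReal.ofReal_mul (norm_nonneg _), ← Real.rpow_two,
      ← ENNReal.ofReal_rpow_of_nonneg (norm_nonneg _) (by norm_num), ofReal_norm, ofReal_norm]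
  -- Sobolev: `∫⁻ ‖vⱼ‖ₑ⁶ ≤ (K² R)³`
  have hS : eLpNorm vs 6 volume ≤ K * eLpNorm (fderiv ℝ vs) 2 volume :=
    FluidPDE.eLpNorm_six_le_eLpNorm_fderiv_two volume finrank_euclideanSpace_fin hvs1
      (eLpNorm_two_lt_top_of_lintegral_enorm_sq_lt_top l2vs)
  have hS6 : ∫⁻ x, ‖vs x‖ₑ ^ (6 : ℝ) ≤ ((K : ℝ≥0∞) ^ 2 * ENNReal.ofReal R) ^ (3 : ℝ) := by
    have h6 : ∫⁻ x, ‖vs x‖ₑ ^ (6 : ℝ) = eLpNorm vs 6 volume ^ (6 : ℝ) := by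
      rw [eLpNorm_eq_lintegral_rpow_enorm_toReal (by norm_num) (by norm_num), ENNReal.toReal_ofNat,
        ← ENNReal.rpow_mul]
      norm_num
    rw [h6]
    calc eLpNorm vs 6 volume ^ (6 : ℝ) ≤ (K * eLpNorm (fderiv ℝ vs) 2 volume) ^ (6 : ℝ) := by gcongr
      _ = ((K : ℝ≥0∞) ^ 2 * eLpNorm (fderiv ℝ vs) 2 volume ^ 2) ^ (3 : ℝ) := by
          rw [← mul_pow, ← ENNReal.rpow_natCast, ← ENNReal.rpow_mul]; norm_num
      _ ≤ ((K : ℝ≥0∞) ^ 2 * ENNReal.ofReal R) ^ (3 : ℝ) := by gcongr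
  -- Hölder `(ρ, m/2)` and interpolation
  have hHolder : ∫⁻ x, ‖fderiv ℝ v x‖ₑ * ‖vs x‖ₑ ^ (2 : ℝ) ≤
      (∫⁻ x, ‖fderiv ℝ v x‖ₑ ^ ρ) ^ (1 / ρ) * (∫⁻ x, ‖vs x‖ₑ ^ m) ^ (2 / m) := by
    have h := ENNReal.lintegral_mul_le_Lp_mul_Lq volume hconj
      (f := fun x => ‖fderiv ℝ v x‖ₑ) (g := fun x => ‖vs x‖ₑ ^ (2 : ℝ))
      cDv.aemeasurable.enorm (cvs.aemeasurable.enorm.pow_const _)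
    have hgm' : ∀ x, (‖vs x‖ₑ ^ (2 : ℝ)) ^ (m / 2) = ‖vs x‖ₑ ^ m := fun x => by
      rw [← ENNReal.rpow_mul]; congr 1; field_simp
    simp only [Pi.mul_apply, hgm'] at h
    have e2 : 1 / (m / 2) = 2 / m := by field_simp
    rwa [e2] at h
  have hInterp : ∫⁻ x, ‖vs x‖ₑ ^ m ≤
      (∫⁻ x, ‖vs x‖ₑ ^ (2 : ℝ)) ^ ((6 - m) / (6 - 2)) * (∫⁻ x, ‖vs x‖ₑ ^ (6 : ℝ)) ^ ((m - 2) / (6 - 2)) :=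
    lintegral_rpow_interpolate cvs.aemeasurable.enorm zero_lt_two (by norm_num) h2m.le hm6.le
  -- assemble in `ℝ≥0∞`
  have hN : (∫⁻ x, ‖fderiv ℝ v x‖ₑ ^ ρ) ^ (1 / ρ) = eLpNorm (fderiv ℝ v) r volume := by
    rw [eLpNorm_eq_lintegral_rpow_enorm_toReal hr0 hrtop, ← hρ]
  have hcomb : ENNReal.ofReal (∫ x, g x) ≤
      eLpNorm (fderiv ℝ v) r volume * (ENNReal.ofReal a ^ (1 - 3 / (2 * ρ)) *
        ((K : ℝ≥0∞) ^ 2 * ENNReal.ofReal R) ^ (3 / (2 * ρ))) := by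
    rw [hP]
    refine hHolder.trans ?_
    rw [hN]
    gcongr
    calc (∫⁻ x, ‖vs x‖ₑ ^ m) ^ (2 / m)
        ≤ ((∫⁻ x, ‖vs x‖ₑ ^ (2 : ℝ)) ^ ((6 - m) / (6 - 2)) *
            (∫⁻ x, ‖vs x‖ₑ ^ (6 : ℝ)) ^ ((m - 2) / (6 - 2))) ^ (2 / m) := by gcongr
      _ = (∫⁻ x, ‖vs x‖ₑ ^ (2 : ℝ)) ^ (1 - 3 / (2 * ρ)) * ((∫⁻ x, ‖vs x‖ₑ ^ (6 : ℝ)) ^ (1 / (2 * ρ))) := by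
          rw [ENNReal.mul_rpow_of_nonneg _ _ (by positivity), ← ENNReal.rpow_mul,
            ← ENNReal.rpow_mul, hexpθ, hexp1]
      _ ≤ (∫⁻ x, ‖vs x‖ₑ ^ (2 : ℝ)) ^ (1 - 3 / (2 * ρ)) *
            ((((K : ℝ≥0∞) ^ 2 * ENNReal.ofReal R) ^ (3 : ℝ)) ^ (1 / (2 * ρ))) := by gcongr
      _ = ENNReal.ofReal a ^ (1 - 3 / (2 * ρ)) * ((K : ℝ≥0∞) ^ 2 * ENNReal.ofReal R) ^ (3 / (2 * ρ)) := by
          rw [hA, ← ENNReal.rpow_mul]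
          congr 2; field_simp
  -- back to reals
  have h32 : 0 ≤ 1 - 3 / (2 * ρ) := by
    rw [sub_nonneg, div_le_one (by positivity)]; linarith
  have hfinR : eLpNorm (fderiv ℝ v) r volume * (ENNReal.ofReal a ^ (1 - 3 / (2 * ρ)) *
      ((K : ℝ≥0∞) ^ 2 * ENNReal.ofReal R) ^ (3 / (2 * ρ))) ≠ ⊤ := by
    refine ENNReal.mul_ne_top hvr.ne (ENNReal.mul_ne_top ?_ ?_)
    · exact ENNReal.rpow_ne_top_of_nonneg h32 ENNReal.ofReal_ne_top
    · exact ENNReal.rpow_ne_top_of_nonneg (by positivity)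
        (ENNReal.mul_ne_top (ENNReal.pow_ne_top ENNReal.coe_ne_top) ENNReal.ofReal_ne_top)
  have := (ENNReal.ofReal_le_iff_le_toReal hfinR).1 hcomb
  refine this.trans_eq ?_
  rw [ENNReal.toReal_mul, ENNReal.toReal_mul, ← ENNReal.toReal_rpow,
    ← ENNReal.toReal_rpow, ENNReal.toReal_mul, ENNReal.toReal_pow, ENNReal.toReal_ofReal ha0,
    ENNReal.toReal_ofReal hR0, ENNReal.coe_toReal, mul_assoc]

end KeyEstimate

/-! ### The trilinear identity `∫ ⟪Δv, (v·∇)v⟫ = -Σᵢ ∫ ⟪∂ᵢv, Dv ∂ᵢv⟫` on `ℝ³` -/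

section Trilinear

/-- Bookkeeping of the Beirão da Veiga constant: with the Young weight `N K^{2(1-θ)}`,
`θ (2(1-θ))^{(1-θ)/θ} ν^{-(1-θ)/θ} (N K^{2(1-θ)})^{1/θ} = C(θ) ν^{1-1/θ} N^{1/θ}`,
`C(θ) = θ (2(1-θ))^{(1-θ)/θ} K^{2(1-θ)/θ}` (so that `ν` enters as `ν^{1-q}`, `q = 1/θ`). [folklore] -/
private theorem bdv_const_identity {θ ν N K : ℝ} (hθ0 : 0 < θ) (hN : 0 ≤ N) (hK : 0 ≤ K) :
    θ * (2 * (1 - θ)) ^ ((1 - θ) / θ) * ν ^ (-((1 - θ) / θ)) * (N * K ^ (2 * (1 - θ))) ^ (1 / θ) =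
      (θ * (2 * (1 - θ)) ^ ((1 - θ) / θ) * K ^ (2 * (1 - θ) / θ)) * ν ^ (1 - 1 / θ) * N ^ (1 / θ) := by
  have hsplit : (N * K ^ (2 * (1 - θ))) ^ (1 / θ) = N ^ (1 / θ) * K ^ (2 * (1 - θ) / θ) := by
    rw [Real.mul_rpow hN (Real.rpow_nonneg hK _), ← Real.rpow_mul hK]
    have hKexp : 2 * (1 - θ) * (1 / θ) = 2 * (1 - θ) / θ := by field_simp
    rw [hKexp]
  have hνpow : ν ^ (-((1 - θ) / θ)) = ν ^ (1 - 1 / θ) := by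
    congr 1
    field_simp
    ring
  rw [hsplit, hνpow]
  ring

/-- **The derivative of the convective term**: for a `C²` field `v` on `ℝ³`,
`∂ᵢ((v·∇)v) = Dv(∂ᵢv) + (v·∇)(∂ᵢv)` (Leibniz rule `fderiv_clm_apply` and the symmetry of second
derivatives `fderiv_fderiv_apply_comm_of_contDiff_two`). [folklore] -/
private theorem fderiv_convect_self_apply_basisFun
    {v : EuclideanSpace ℝ (Fin 3) → EuclideanSpace ℝ (Fin 3)} (hv : ContDiff ℝ 2 v)
    (x : EuclideanSpace ℝ (Fin 3)) (i : Fin 3) :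
    fderiv ℝ (FluidPDE.convect v v) x (EuclideanSpace.basisFun (Fin 3) ℝ i) =
      fderiv ℝ v x (fderiv ℝ v x (EuclideanSpace.basisFun (Fin 3) ℝ i)) +
        FluidPDE.convect v (fun y => fderiv ℝ v y (EuclideanSpace.basisFun (Fin 3) ℝ i)) x := by
  set e := EuclideanSpace.basisFun (Fin 3) ℝ with he
  have hd1 : DifferentiableAt ℝ (fderiv ℝ v) x :=
    ((hv.fderiv_right (m := 1) (by norm_num)).differentiable one_ne_zero) x
  have hd0 : DifferentiableAt ℝ v x := (hv.differentiable (by norm_num)) x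
  have hw : FluidPDE.convect v v = fun y => (fderiv ℝ v y) (v y) := rfl
  rw [hw, fderiv_clm_apply hd1 hd0]
  simp only [add_apply, ContinuousLinearMap.comp_apply, ContinuousLinearMap.flip_apply]
  congr 1
  rw [FluidPDE.convect, fderiv_fderiv_apply_comm_of_contDiff_two hv x (e i) (v x),
    FluidPDE.fderiv_apply_const_apply hd1 (v x) (e i)]

/-- **The trilinear identity behind Beirão da Veiga's estimate**: for a `C³`, bounded,
divergence-free field `v` on `ℝ³` with `Dv` bounded and `Dv, D²v ∈ L²`,
`∫ ⟪Δv, (v·∇)v⟫ = -Σᵢ ∫ ⟪∂ᵢv, Dv(∂ᵢv)⟫` — integration by parts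
`∫⟪Δv, w⟫ = -Σᵢ∫⟪∂ᵢv, ∂ᵢw⟫` (`integral_sum_inner_fderiv_fderiv_eq_neg_integral_inner_laplacian`)
with `w = (v·∇)v`, `∂ᵢw = Dv(∂ᵢv) + (v·∇)∂ᵢv`, and the transport term `∫⟪∂ᵢv, (v·∇)∂ᵢv⟫ = 0`
(`integral_inner_convect_transport_eq_zero`, `div v = 0`). In coordinates this is
`∫ Δu·(u·∇)u = -Σ_{ijk} ∫ ∂ₖuⱼ ∂ⱼuᵢ ∂ₖuᵢ` (Beirão da Veiga 1995; Berselli–Galdi 2002, proof of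
Thm. 1.1, the term `∫ ∇u ∇u ∇u`). [cite: BerselliGaldi2002, (1.3) p. 3586] -/
theorem integral_inner_laplacian_convect_eq_neg_sum
    {v : EuclideanSpace ℝ (Fin 3) → EuclideanSpace ℝ (Fin 3)} (hv : ContDiff ℝ 3 v)
    (hdiv : VectorCalculus.IsDivFree v) {B : ℝ} (hB : ∀ x, ‖v x‖ ≤ B)
    {B₁ : ℝ} (hB₁ : ∀ x, ‖fderiv ℝ v x‖ ≤ B₁)
    (hv1 : ∫⁻ x, ‖iteratedFDeriv ℝ 1 v x‖ₑ ^ 2 < ⊤) (hv2 : ∫⁻ x, ‖iteratedFDeriv ℝ 2 v x‖ₑ ^ 2 < ⊤) :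
    ∫ x, ⟪(Δ v) x, FluidPDE.convect v v x⟫ =
      - ∑ i, ∫ x, ⟪fderiv ℝ v x (EuclideanSpace.basisFun (Fin 3) ℝ i),
          fderiv ℝ v x (fderiv ℝ v x (EuclideanSpace.basisFun (Fin 3) ℝ i))⟫ := by
  set e := EuclideanSpace.basisFun (Fin 3) ℝ with he
  have he1 : ∀ i, ‖e i‖ = 1 := fun i => by simp [he]
  have hB0 : 0 ≤ B := (norm_nonneg _).trans (hB 0)
  have hB₁0 : 0 ≤ B₁ := (norm_nonneg _).trans (hB₁ 0)
  have hv2' : ContDiff ℝ 2 v := hv.of_le (by norm_num)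
  have hv1' : ContDiff ℝ 1 v := hv.of_le (by norm_num)
  set w : EuclideanSpace ℝ (Fin 3) → EuclideanSpace ℝ (Fin 3) := FluidPDE.convect v v with hwdef
  have hw : ContDiff ℝ 1 w := (hv.fderiv_right (m := 1) (by norm_num)).clm_apply hv1'
  -- slices
  set vs : Fin 3 → EuclideanSpace ℝ (Fin 3) → EuclideanSpace ℝ (Fin 3) :=
    fun i y => fderiv ℝ v y (e i) with hvs
  have hvs2 : ∀ i, ContDiff ℝ 2 (vs i) := fun i =>
    (hv.fderiv_right (m := 2) (by norm_num)).clm_apply contDiff_const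
  have hvs1 : ∀ i, ContDiff ℝ 1 (vs i) := fun i => (hvs2 i).of_le (by norm_num)
  -- continuity
  have cv : Continuous v := hv.continuous
  have cDv : Continuous (fderiv ℝ v) := hv.continuous_fderiv (by norm_num)
  have cvs : ∀ i, Continuous (vs i) := fun i => (hvs1 i).continuous
  have cDvs : ∀ i, Continuous (fderiv ℝ (vs i)) := fun i => (hvs1 i).continuous_fderiv one_ne_zero
  have cddv : ∀ i, Continuous fun x => fderiv ℝ (vs i) x (e i) := fun i =>
    (cDvs i).clm_apply continuous_const
  have cw : Continuous w := cDv.clm_apply cv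
  have cDw : Continuous (fderiv ℝ w) := hw.continuous_fderiv one_ne_zero
  have cdiw : ∀ i, Continuous fun x => fderiv ℝ w x (e i) := fun i => cDw.clm_apply continuous_const
  -- pointwise norm bounds
  have hDv_eq : ∀ x, ‖fderiv ℝ v x‖ = ‖iteratedFDeriv ℝ 1 v x‖ := fun x => by
    rw [← norm_iteratedFDeriv_fderiv, norm_iteratedFDeriv_zero]
  have n_vs : ∀ i x, ‖vs i x‖ ≤ ‖fderiv ℝ v x‖ := fun i x => by
    simpa [he1] using (fderiv ℝ v x).le_opNorm (e i)
  have n_Dvs : ∀ i x, ‖fderiv ℝ (vs i) x‖ ≤ ‖iteratedFDeriv ℝ 2 v x‖ := fun i x => by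
    have h : ‖fderiv ℝ (vs i) x‖ = ‖iteratedFDeriv ℝ 1 (vs i) x‖ := by
      rw [← norm_iteratedFDeriv_fderiv, norm_iteratedFDeriv_zero]
    rw [h]
    exact norm_iteratedFDeriv_fderiv_apply_basisFun_le hv 1 (by norm_num) x i
  have n_ddv : ∀ i x, ‖fderiv ℝ (vs i) x (e i)‖ ≤ ‖iteratedFDeriv ℝ 2 v x‖ := fun i x => by
    have h1 : ‖fderiv ℝ (vs i) x (e i)‖ ≤ ‖fderiv ℝ (vs i) x‖ := by
      simpa [he1] using (fderiv ℝ (vs i) x).le_opNorm (e i)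
    exact h1.trans (n_Dvs i x)
  have n_w : ∀ x, ‖w x‖ ≤ ‖B • fderiv ℝ v x‖ := fun x => by
    rw [hwdef, FluidPDE.convect, norm_smul, Real.norm_of_nonneg hB0, mul_comm]
    exact (fderiv ℝ v x).le_opNorm_of_le (hB x)
  -- finite `L²` norms
  have l2Dv : ∫⁻ x, ‖fderiv ℝ v x‖ₑ ^ 2 < ⊤ :=
    lintegral_enorm_sq_lt_top_of_norm_le (fun x => (hDv_eq x).le) hv1
  have l2vs : ∀ i, ∫⁻ x, ‖vs i x‖ₑ ^ 2 < ⊤ := fun i =>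
    lintegral_enorm_sq_lt_top_of_norm_le (n_vs i) l2Dv
  have l2Dvs : ∀ i, ∫⁻ x, ‖fderiv ℝ (vs i) x‖ₑ ^ 2 < ⊤ := fun i =>
    lintegral_enorm_sq_lt_top_of_norm_le (n_Dvs i) hv2
  have l2ddv : ∀ i, ∫⁻ x, ‖fderiv ℝ (vs i) x (e i)‖ₑ ^ 2 < ⊤ := fun i =>
    lintegral_enorm_sq_lt_top_of_norm_le (n_ddv i) hv2
  have l2smul : ∀ (c : ℝ) {f : EuclideanSpace ℝ (Fin 3) → (EuclideanSpace ℝ (Fin 3) →L[ℝ]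
      EuclideanSpace ℝ (Fin 3))}, ∫⁻ x, ‖f x‖ₑ ^ 2 < ⊤ → ∫⁻ x, ‖c • f x‖ₑ ^ 2 < ⊤ := by
    intro c f hf
    have : ∀ x, ‖c • f x‖ₑ ^ 2 = ‖c‖ₑ ^ 2 * ‖f x‖ₑ ^ 2 := fun x => by
      rw [enorm_smul, mul_pow]
    simp_rw [this]
    rw [lintegral_const_mul' _ _ (by simp)]
    exact ENNReal.mul_lt_top (by simp) hf
  have cBDv : Continuous fun x => B • fderiv ℝ v x := cDv.const_smul B
  have cB₁Dv : Continuous fun x => B₁ • fderiv ℝ v x := cDv.const_smul B₁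
  have cBDvs : ∀ i, Continuous fun x => B • fderiv ℝ (vs i) x := fun i => (cDvs i).const_smul B
  -- the derivative of `w`
  have hdw : ∀ i x, fderiv ℝ w x (e i) = fderiv ℝ v x (vs i x) + FluidPDE.convect v (vs i) x :=
    fun i x => fderiv_convect_self_apply_basisFun hv2' x i
  -- integrability
  have i1 : ∀ i, Integrable (fun x => ⟪fderiv ℝ (vs i) x (e i), w x⟫) volume := fun i =>
    integrable_of_norm_le_mul_of_lintegral_sq ((cddv i).inner cw).aestronglyMeasurable (cddv i) cBDv
      (l2ddv i) (l2smul B l2Dv) fun x => (norm_inner_le_norm _ _).trans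
        (mul_le_mul_of_nonneg_left (n_w x) (norm_nonneg _))
  have i3 : ∀ i, Integrable (fun x => ⟪vs i x, w x⟫) volume := fun i =>
    integrable_of_norm_le_mul_of_lintegral_sq ((cvs i).inner cw).aestronglyMeasurable (cvs i) cBDv
      (l2vs i) (l2smul B l2Dv) fun x => (norm_inner_le_norm _ _).trans
        (mul_le_mul_of_nonneg_left (n_w x) (norm_nonneg _))
  have i2a : ∀ i, Integrable (fun x => ⟪vs i x, fderiv ℝ v x (vs i x)⟫) volume := fun i =>
    integrable_of_norm_le_mul_of_lintegral_sq ((cvs i).inner (cDv.clm_apply (cvs i))).aestronglyMeasurable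
      (cvs i) cB₁Dv (l2vs i) (l2smul B₁ l2Dv) fun x => (norm_inner_le_norm _ _).trans (by
        refine mul_le_mul_of_nonneg_left ?_ (norm_nonneg _)
        rw [norm_smul, Real.norm_of_nonneg hB₁0]
        calc ‖fderiv ℝ v x (vs i x)‖ ≤ ‖fderiv ℝ v x‖ * ‖vs i x‖ := (fderiv ℝ v x).le_opNorm _
          _ ≤ ‖fderiv ℝ v x‖ * ‖fderiv ℝ v x‖ :=
              mul_le_mul_of_nonneg_left (n_vs i x) (norm_nonneg _)
          _ ≤ B₁ * ‖fderiv ℝ v x‖ := mul_le_mul_of_nonneg_right (hB₁ x) (norm_nonneg _))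
  have i2b : ∀ i, Integrable (fun x => ⟪vs i x, FluidPDE.convect v (vs i) x⟫) volume := fun i =>
    integrable_of_norm_le_mul_of_lintegral_sq
      ((cvs i).inner ((cDvs i).clm_apply cv)).aestronglyMeasurable (cvs i) (cBDvs i) (l2vs i)
      (l2smul B (l2Dvs i)) fun x => (norm_inner_le_norm _ _).trans (by
        refine mul_le_mul_of_nonneg_left ?_ (norm_nonneg _)
        rw [FluidPDE.convect, norm_smul, Real.norm_of_nonneg hB0, mul_comm]
        exact (fderiv ℝ (vs i) x).le_opNorm_of_le (hB x))
  have i2 : ∀ i, Integrable (fun x => ⟪vs i x, fderiv ℝ w x (e i)⟫) volume := fun i => by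
    have h := (i2a i).add (i2b i)
    refine h.congr (Eventually.of_forall fun x => ?_)
    simp only [Pi.add_apply, hdw i x, inner_add_right]
  -- integration by parts
  have hL := integral_sum_inner_fderiv_fderiv_eq_neg_integral_inner_laplacian hv2' hw i1 i2 i3
  -- the transport terms vanish
  have htr : ∀ i, ∫ x, ⟪vs i x, FluidPDE.convect v (vs i) x⟫ = 0 := by
    intro i
    have hswap : (fun x => ⟪vs i x, FluidPDE.convect v (vs i) x⟫) =
        fun x => ⟪FluidPDE.convect v (vs i) x, vs i x⟫ := funext fun x => real_inner_comm _ _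
    rw [hswap]
    refine integral_inner_convect_transport_eq_zero hv1' hdiv hB (hvs1 i) ?_ ?_
    · exact (memLp_two_iff_integrable_sq_norm (cvs i).aestronglyMeasurable).2
        (FluidPDE.integrable_sq_norm_of_lintegral_lt_top (cvs i) (l2vs i))
    · exact (memLp_two_iff_integrable_sq_norm (cDvs i).aestronglyMeasurable).2
        (FluidPDE.integrable_sq_norm_of_lintegral_lt_top (cDvs i) (l2Dvs i))
  have hsplit : ∀ i, ∫ x, ⟪vs i x, fderiv ℝ w x (e i)⟫ =
      ∫ x, ⟪vs i x, fderiv ℝ v x (vs i x)⟫ := by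
    intro i
    have h1 : (fun x => ⟪vs i x, fderiv ℝ w x (e i)⟫) =
        fun x => ⟪vs i x, fderiv ℝ v x (vs i x)⟫ + ⟪vs i x, FluidPDE.convect v (vs i) x⟫ :=
      funext fun x => by rw [hdw i x, inner_add_right]
    rw [h1, integral_add (i2a i) (i2b i), htr i, add_zero]
  have hL' : ∫ x, ⟪(Δ v) x, w x⟫ = - ∫ x, ∑ i, ⟪vs i x, fderiv ℝ w x (e i)⟫ := by
    rw [hL, neg_neg]
  rw [hL', integral_finsetSum _ fun i _ => i2 i]
  congr 1
  exact Finset.sum_congr rfl fun i _ => hsplit i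

end Trilinear

/-! ### The enstrophy production at a fixed time, in the Beirão da Veiga class -/

section Slice

/-- **The enstrophy production bound in the Beirão da Veiga class** (Beirão da Veiga 1995;
Berselli–Galdi 2002, (1.3); the energy method of Lemarié-Rieusset 2016, Thm. 11.2 with the
trilinear term estimated by `‖∇u‖_{L^r}`). Let `v : ℝ³ → ℝ³` be `C³` and divergence free,
`W : ℝ³ → ℝ³` and `q : ℝ³ → ℝ` be `C¹`, with the momentum equation `W + (v·∇)v = νΔv - ∇q`
(`ν > 0`), `v` and `Dv` bounded (for integrability only), `Dv, D²v, D³v, W, DW, q, Dq ∈ L²`, and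
`Dv ∈ L^r`, `3/2 < r < ∞`. With `θ = 1 - 3/(2r)` (so `q = 1/θ = 2r/(2r-3)`, `2/q + 3/r = 2`):
`∫ Σᵢ ⟪∂ᵢv, ∂ᵢW⟫ ≤ C(θ) ν^{1-1/θ} ‖Dv‖_{L^r}^{1/θ} ∫ |∇v|²`,
`C(θ) = θ (2(1-θ))^{(1-θ)/θ} K^{2(1-θ)/θ}`.
Proof: `∫ Σᵢ⟪∂ᵢv, ∂ᵢW⟫ = -∫⟪Δv, W⟫ = -ν‖Δv‖²₂ + ∫⟪Δv, (v·∇)v⟫` (the pressure term vanishes,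
`div Δv = 0`), `∫⟪Δv, (v·∇)v⟫ = -Σⱼ∫⟪∂ⱼv, Dv ∂ⱼv⟫ ≤ Σⱼ ∫ ‖Dv‖ ‖∂ⱼv‖²`
(`integral_inner_laplacian_convect_eq_neg_sum`), then
`integral_norm_fderiv_mul_sq_norm_fderiv_apply_le` and `bdv_absorb_component` for each `j` and
the Hessian–Laplacian identity `Σⱼ Σᵢ ‖∂ᵢ∂ⱼv‖²₂ = ‖Δv‖²₂` — half the dissipation absorbs the
Young remainder, the other half is dropped. [cite: BerselliGaldi2002, (1.3) p. 3586]
[cite: LemarieRieusset2016, §11.5 p. 329 (PDF p. 353)] -/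
theorem integral_sum_inner_fderiv_le_of_momentum_of_gradient_eLpNorm {ν : ℝ} (hν : 0 < ν)
    {v W : EuclideanSpace ℝ (Fin 3) → EuclideanSpace ℝ (Fin 3)} {q : EuclideanSpace ℝ (Fin 3) → ℝ}
    (hv : ContDiff ℝ 3 v) (hW : ContDiff ℝ 1 W) (hq : ContDiff ℝ 1 q)
    (hmom : ∀ x, W x + FluidPDE.convect v v x = ν • (Δ v) x - gradient q x)
    (hdiv : VectorCalculus.IsDivFree v) {B : ℝ} (hB : ∀ x, ‖v x‖ ≤ B)
    {B₁ : ℝ} (hB₁ : ∀ x, ‖fderiv ℝ v x‖ ≤ B₁)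
    {r : ℝ≥0∞} (hr : 3 / 2 < r) (hrtop : r ≠ ⊤) (hvr : eLpNorm (fderiv ℝ v) r volume < ⊤)
    {θ : ℝ} (hθ : θ = 1 - 3 / (2 * r.toReal))
    (hv1 : ∫⁻ x, ‖iteratedFDeriv ℝ 1 v x‖ₑ ^ 2 < ⊤) (hv2 : ∫⁻ x, ‖iteratedFDeriv ℝ 2 v x‖ₑ ^ 2 < ⊤)
    (hv3 : ∫⁻ x, ‖iteratedFDeriv ℝ 3 v x‖ₑ ^ 2 < ⊤)
    (hW0 : ∫⁻ x, ‖W x‖ₑ ^ 2 < ⊤) (hW1 : ∫⁻ x, ‖iteratedFDeriv ℝ 1 W x‖ₑ ^ 2 < ⊤)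
    (hq0 : ∫⁻ x, ‖q x‖ₑ ^ 2 < ⊤) (hq1 : ∫⁻ x, ‖iteratedFDeriv ℝ 1 q x‖ₑ ^ 2 < ⊤) :
    ∫ x, ∑ i, ⟪fderiv ℝ v x (EuclideanSpace.basisFun (Fin 3) ℝ i),
        fderiv ℝ W x (EuclideanSpace.basisFun (Fin 3) ℝ i)⟫ ≤
      (θ * (2 * (1 - θ)) ^ ((1 - θ) / θ) *
          (SNormLESNormFDerivOfEqConst (EuclideanSpace ℝ (Fin 3))
            (volume : Measure (EuclideanSpace ℝ (Fin 3))) 2 : ℝ) ^ (2 * (1 - θ) / θ)) *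
        ν ^ (1 - 1 / θ) * (eLpNorm (fderiv ℝ v) r volume).toReal ^ (1 / θ) *
        ∫ x, FluidPDE.frobeniusNormSq (fderiv ℝ v x) := by
  set e := EuclideanSpace.basisFun (Fin 3) ℝ with he
  have he1 : ∀ i, ‖e i‖ = 1 := fun i => by simp [he]
  set K : ℝ≥0 := SNormLESNormFDerivOfEqConst (EuclideanSpace ℝ (Fin 3))
    (volume : Measure (EuclideanSpace ℝ (Fin 3))) 2 with hK
  set N : ℝ := (eLpNorm (fderiv ℝ v) r volume).toReal with hNdef
  have hN0 : 0 ≤ N := ENNReal.toReal_nonneg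
  have hB0 : 0 ≤ B := (norm_nonneg _).trans (hB 0)
  have hB₁0 : 0 ≤ B₁ := (norm_nonneg _).trans (hB₁ 0)
  -- the exponent `θ ∈ (0, 1)`
  have hr0 : r ≠ 0 := (lt_trans (by norm_num) hr).ne'
  have hρ3 : 3 / 2 < r.toReal := by
    have h : ((3 / 2 : ℝ≥0∞)).toReal < r.toReal :=
      (ENNReal.toReal_lt_toReal (ENNReal.div_ne_top (by norm_num) (by norm_num)) hrtop).2 hr
    have h32 : ((3 / 2 : ℝ≥0∞)).toReal = 3 / 2 := by
      rw [ENNReal.toReal_div, ENNReal.toReal_ofNat, ENNReal.toReal_ofNat]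
    rw [h32] at h
    exact h
  have hρ0 : 0 < r.toReal := by linarith
  have hθ0 : 0 < θ := by
    rw [hθ, sub_pos, div_lt_one (by positivity)]; linarith
  have hθ1 : θ < 1 := by
    rw [hθ]; linarith [div_pos (zero_lt_three' ℝ) (by positivity : (0 : ℝ) < 2 * r.toReal)]
  -- smoothness and continuity
  have hv2' : ContDiff ℝ 2 v := hv.of_le (by norm_num)
  have hΔ1 : ContDiff ℝ 1 (Δ v) := contDiff_one_laplacian_of_contDiff_three hv
  have cv : Continuous v := hv.continuous
  have cDv : Continuous (fderiv ℝ v) := hv.continuous_fderiv (by norm_num)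
  have cD2 : Continuous fun x => iteratedFDeriv ℝ 2 v x := hv.continuous_iteratedFDeriv (by norm_num)
  have cD3 : Continuous fun x => iteratedFDeriv ℝ 3 v x := hv.continuous_iteratedFDeriv (by norm_num)
  have cdiv : ∀ i, Continuous fun x => fderiv ℝ v x (e i) := fun i => cDv.clm_apply continuous_const
  have cdvs : ∀ j i, Continuous fun x => fderiv ℝ (fun y => fderiv ℝ v y (e j)) x (e i) := fun j i =>
    ((((hv.fderiv_right (m := 2) (by norm_num)).clm_apply contDiff_const).continuous_fderiv
      (by norm_num)).clm_apply continuous_const)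
  have cW : Continuous W := hW.continuous
  have cDW : Continuous (fderiv ℝ W) := hW.continuous_fderiv one_ne_zero
  have cdiW : ∀ i, Continuous fun x => fderiv ℝ W x (e i) := fun i => cDW.clm_apply continuous_const
  have cq : Continuous q := hq.continuous
  have cDq : Continuous (fderiv ℝ q) := hq.continuous_fderiv one_ne_zero
  have cdiq : ∀ i, Continuous fun x => fderiv ℝ q x (e i) := fun i => cDq.clm_apply continuous_const
  have cgq : Continuous (gradient q) := by
    have : gradient q = fun x => (InnerProductSpace.toDual ℝ _).symm (fderiv ℝ q x) := rfl
    rw [this]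
    exact (InnerProductSpace.toDual ℝ (EuclideanSpace ℝ (Fin 3))).symm.continuous.comp cDq
  have cΔ : Continuous (Δ v) := hΔ1.continuous
  have cdΔ : ∀ i, Continuous fun x => fderiv ℝ (Δ v) x (e i) := fun i =>
    (hΔ1.continuous_fderiv one_ne_zero).clm_apply continuous_const
  have cconv : Continuous (FluidPDE.convect v v) := cDv.clm_apply cv
  have c3D2 : Continuous fun x => (3 : ℝ) • iteratedFDeriv ℝ 2 v x := cD2.const_smul (3 : ℝ)
  have c3D3 : Continuous fun x => (3 : ℝ) • iteratedFDeriv ℝ 3 v x := cD3.const_smul (3 : ℝ)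
  have cBDv : Continuous fun x => B • fderiv ℝ v x := cDv.const_smul B
  have cB₁div : ∀ j, Continuous fun x => B₁ • fderiv ℝ v x (e j) := fun j => (cdiv j).const_smul B₁
  -- pointwise norm bounds
  have hDv_eq : ∀ x, ‖fderiv ℝ v x‖ = ‖iteratedFDeriv ℝ 1 v x‖ := fun x => by
    rw [← norm_iteratedFDeriv_fderiv, norm_iteratedFDeriv_zero]
  have n_Δ : ∀ x, ‖(Δ v) x‖ ≤ ‖(3 : ℝ) • iteratedFDeriv ℝ 2 v x‖ := fun x => by
    rw [norm_smul, Real.norm_of_nonneg (by norm_num : (0 : ℝ) ≤ 3)]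
    exact norm_laplacian_le_three_mul_norm_iteratedFDeriv_two hv2' x
  have n_dΔ : ∀ i x, ‖fderiv ℝ (Δ v) x (e i)‖ ≤ ‖(3 : ℝ) • iteratedFDeriv ℝ 3 v x‖ := fun i x => by
    rw [norm_smul, Real.norm_of_nonneg (by norm_num : (0 : ℝ) ≤ 3),
      fderiv_laplacian_apply_of_contDiff_three hv x (e i)]
    exact (norm_laplacian_le_three_mul_norm_iteratedFDeriv_two
      ((hv.fderiv_right (m := 2) (by norm_num)).clm_apply contDiff_const) x).trans
      (mul_le_mul_of_nonneg_left (norm_iteratedFDeriv_fderiv_apply_basisFun_le hv 2 (by norm_num) x i)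
        (by norm_num))
  have n_conv : ∀ x, ‖FluidPDE.convect v v x‖ ≤ ‖B • fderiv ℝ v x‖ := fun x => by
    rw [FluidPDE.convect, norm_smul, Real.norm_of_nonneg hB0, mul_comm]
    exact (fderiv ℝ v x).le_opNorm_of_le (hB x)
  have n_gq : ∀ x, ‖gradient q x‖ = ‖iteratedFDeriv ℝ 1 q x‖ := fun x => by
    rw [gradient, LinearIsometryEquiv.norm_map, ← norm_iteratedFDeriv_fderiv, norm_iteratedFDeriv_zero]
  have hin : ∀ i (y : EuclideanSpace ℝ (Fin 3)), ‖⟪e i, y⟫‖ ≤ ‖y‖ := fun i y =>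
    (norm_inner_le_norm (𝕜 := ℝ) (e i) y).trans (by rw [he1, one_mul])
  -- finite `L²` norms
  have l2Dv : ∫⁻ x, ‖fderiv ℝ v x‖ₑ ^ 2 < ⊤ :=
    lintegral_enorm_sq_lt_top_of_norm_le (fun x => (hDv_eq x).le) hv1
  have l2smul3 : ∀ {n : ℕ}, ∫⁻ x, ‖iteratedFDeriv ℝ n v x‖ₑ ^ 2 < ⊤ →
      ∫⁻ x, ‖(3 : ℝ) • iteratedFDeriv ℝ n v x‖ₑ ^ 2 < ⊤ := by
    intro n h
    have : ∀ x, ‖(3 : ℝ) • iteratedFDeriv ℝ n v x‖ₑ ^ 2 =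
        ENNReal.ofReal (3 ^ 2) * ‖iteratedFDeriv ℝ n v x‖ₑ ^ 2 := by
      intro x
      rw [enorm_smul, mul_pow, Real.enorm_eq_ofReal (by norm_num : (0:ℝ) ≤ 3),
        ENNReal.ofReal_pow (by norm_num : (0:ℝ) ≤ 3)]
    simp_rw [this]
    rw [lintegral_const_mul' _ _ ENNReal.ofReal_ne_top]
    exact ENNReal.mul_lt_top ENNReal.ofReal_lt_top h
  have l2Δ : ∫⁻ x, ‖(3 : ℝ) • iteratedFDeriv ℝ 2 v x‖ₑ ^ 2 < ⊤ := l2smul3 hv2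
  have l2dΔ : ∫⁻ x, ‖(3 : ℝ) • iteratedFDeriv ℝ 3 v x‖ₑ ^ 2 < ⊤ := l2smul3 hv3
  have l2BDv : ∫⁻ x, ‖B • fderiv ℝ v x‖ₑ ^ 2 < ⊤ := by
    have : ∀ x, ‖B • fderiv ℝ v x‖ₑ ^ 2 = ‖B‖ₑ ^ 2 * ‖fderiv ℝ v x‖ₑ ^ 2 := fun x => by
      rw [enorm_smul, mul_pow]
    simp_rw [this]
    rw [lintegral_const_mul' _ _ (by simp)]
    exact ENNReal.mul_lt_top (by simp) l2Dv
  have l2gq : ∫⁻ x, ‖gradient q x‖ₑ ^ 2 < ⊤ :=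
    lintegral_enorm_sq_lt_top_of_norm_le (fun x => (n_gq x).le) hq1
  have l2diq : ∀ i, ∫⁻ x, ‖fderiv ℝ q x (e i)‖ₑ ^ 2 < ⊤ := fun i =>
    lintegral_enorm_sq_lt_top_of_norm_le (fun x => norm_fderiv_apply_basisFun_le q x i) hq1
  have l2div : ∀ i, ∫⁻ x, ‖fderiv ℝ v x (e i)‖ₑ ^ 2 < ⊤ := fun i =>
    lintegral_enorm_sq_lt_top_of_norm_le (fun x => by
      simpa [he1] using (fderiv ℝ v x).le_opNorm (e i)) l2Dv
  have l2B₁div : ∀ j, ∫⁻ x, ‖B₁ • fderiv ℝ v x (e j)‖ₑ ^ 2 < ⊤ := by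
    intro j
    have : ∀ x, ‖B₁ • fderiv ℝ v x (e j)‖ₑ ^ 2 = ‖B₁‖ₑ ^ 2 * ‖fderiv ℝ v x (e j)‖ₑ ^ 2 :=
      fun x => by rw [enorm_smul, mul_pow]
    simp_rw [this]
    rw [lintegral_const_mul' _ _ (by simp)]
    exact ENNReal.mul_lt_top (by simp) (l2div j)
  have l2diW : ∀ i, ∫⁻ x, ‖fderiv ℝ W x (e i)‖ₑ ^ 2 < ⊤ := fun i =>
    lintegral_enorm_sq_lt_top_of_norm_le (fun x => norm_fderiv_apply_basisFun_le W x i) hW1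
  have l2ddv : ∀ i, ∫⁻ x, ‖fderiv ℝ (fun y => fderiv ℝ v y (e i)) x (e i)‖ₑ ^ 2 < ⊤ := fun i =>
    lintegral_enorm_sq_lt_top_of_norm_le (fun x => norm_fderiv_fderiv_apply_basisFun_le hv2' x i) hv2
  have l2dvs : ∀ j i, ∫⁻ x, ‖fderiv ℝ (fun y => fderiv ℝ v y (e j)) x (e i)‖ₑ ^ 2 < ⊤ := fun j i =>
    lintegral_enorm_sq_lt_top_of_norm_le (fun x =>
      (norm_fderiv_apply_basisFun_le (fun y => fderiv ℝ v y (e j)) x i).trans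
        (norm_iteratedFDeriv_fderiv_apply_basisFun_le hv 1 (by norm_num) x j)) hv2
  -- integrability of the products
  have i1 : ∀ i, Integrable (fun x => ⟪fderiv ℝ (fun y => fderiv ℝ v y (e i)) x (e i), W x⟫)
      volume := fun i =>
    integrable_of_norm_le_mul_of_lintegral_sq ((cdvs i i).inner cW).aestronglyMeasurable (cdvs i i) cW
      (l2ddv i) hW0 fun x => norm_inner_le_norm _ _
  have i2 : ∀ i, Integrable (fun x => ⟪fderiv ℝ v x (e i), fderiv ℝ W x (e i)⟫) volume := fun i =>
    integrable_of_norm_le_mul_of_lintegral_sq ((cdiv i).inner (cdiW i)).aestronglyMeasurable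
      (cdiv i) (cdiW i) (l2div i) (l2diW i) fun x => norm_inner_le_norm _ _
  have i3 : ∀ i, Integrable (fun x => ⟪fderiv ℝ v x (e i), W x⟫) volume := fun i =>
    integrable_of_norm_le_mul_of_lintegral_sq ((cdiv i).inner cW).aestronglyMeasurable (cdiv i) cW
      (l2div i) hW0 fun x => norm_inner_le_norm _ _
  have iΔΔ : Integrable (fun x => ‖(Δ v) x‖ ^ 2) volume :=
    FluidPDE.integrable_sq_norm_of_lintegral_lt_top cΔ (lintegral_enorm_sq_lt_top_of_norm_le n_Δ l2Δ)
  have iΔg : Integrable (fun x => ⟪(Δ v) x, gradient q x⟫) volume :=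
    integrable_of_norm_le_mul_of_lintegral_sq (cΔ.inner cgq).aestronglyMeasurable c3D2 cgq
      l2Δ l2gq fun x => (norm_inner_le_norm _ _).trans
        (mul_le_mul_of_nonneg_right (n_Δ x) (norm_nonneg _))
  have iΔc : Integrable (fun x => ⟪(Δ v) x, FluidPDE.convect v v x⟫) volume :=
    integrable_of_norm_le_mul_of_lintegral_sq (cΔ.inner cconv).aestronglyMeasurable c3D2 cBDv
      l2Δ l2BDv fun x => (norm_inner_le_norm _ _).trans
        (mul_le_mul (n_Δ x) (n_conv x) (norm_nonneg _) (norm_nonneg _))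
  have iΔW : Integrable (fun x => ⟪(Δ v) x, W x⟫) volume :=
    integrable_of_norm_le_mul_of_lintegral_sq (cΔ.inner cW).aestronglyMeasurable c3D2 cW l2Δ hW0
      fun x => (norm_inner_le_norm _ _).trans (mul_le_mul_of_nonneg_right (n_Δ x) (norm_nonneg _))
  have lfrob : ∫⁻ x, ENNReal.ofReal (FluidPDE.frobeniusNormSq (fderiv ℝ v x)) < ⊤ :=
    calc ∫⁻ x, ENNReal.ofReal (FluidPDE.frobeniusNormSq (fderiv ℝ v x))
        ≤ ∫⁻ x, 3 * ‖fderiv ℝ v x‖ₑ ^ 2 :=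
          lintegral_mono fun x => ofReal_frobeniusNormSq_le_three_mul_enorm_sq _
      _ = 3 * ∫⁻ x, ‖fderiv ℝ v x‖ₑ ^ 2 := lintegral_const_mul' _ _ (by norm_num)
      _ < ⊤ := ENNReal.mul_lt_top (by norm_num) l2Dv
  have ifrob : Integrable (fun x => FluidPDE.frobeniusNormSq (fderiv ℝ v x)) volume :=
    integrable_of_continuous_of_nonneg (FluidPDE.continuous_frobeniusNormSq_fderiv hv (by simp))
      (fun x => FluidPDE.frobeniusNormSq_nonneg _) lfrob
  -- the per-component real quantities
  have i_a : ∀ j, Integrable (fun x => ‖fderiv ℝ v x (e j)‖ ^ 2) volume := fun j =>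
    FluidPDE.integrable_sq_norm_of_lintegral_lt_top (cdiv j) (l2div j)
  have i_dd : ∀ j i, Integrable (fun x => ‖fderiv ℝ (fun y => fderiv ℝ v y (e j)) x (e i)‖ ^ 2)
      volume := fun j i => FluidPDE.integrable_sq_norm_of_lintegral_lt_top (cdvs j i) (l2dvs j i)
  have i_Pj : ∀ j, Integrable (fun x => ‖fderiv ℝ v x‖ * ‖fderiv ℝ v x (e j)‖ ^ 2) volume := by
    intro j
    have hdom : Integrable (fun x => B₁ * ‖fderiv ℝ v x (e j)‖ ^ 2) volume := (i_a j).const_mul _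
    refine hdom.mono' ((cDv.norm.mul ((cdiv j).norm.pow 2)).aestronglyMeasurable)
      (Eventually.of_forall fun x => ?_)
    rw [Real.norm_of_nonneg (mul_nonneg (norm_nonneg _) (sq_nonneg _))]
    exact mul_le_mul_of_nonneg_right (hB₁ x) (sq_nonneg _)
  have i_Tj : ∀ j, Integrable (fun x => ⟪fderiv ℝ v x (e j), fderiv ℝ v x (fderiv ℝ v x (e j))⟫)
      volume := fun j =>
    integrable_of_norm_le_mul_of_lintegral_sq ((cdiv j).inner (cDv.clm_apply (cdiv j))).aestronglyMeasurable
      (cdiv j) (cB₁div j) (l2div j) (l2B₁div j) fun x => (norm_inner_le_norm _ _).trans (by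
        refine mul_le_mul_of_nonneg_left ?_ (norm_nonneg _)
        rw [norm_smul, Real.norm_of_nonneg hB₁0]
        exact ((fderiv ℝ v x).le_opNorm _).trans (mul_le_mul_of_nonneg_right (hB₁ x) (norm_nonneg _)))
  set a : Fin 3 → ℝ := fun j => ∫ x, ‖fderiv ℝ v x (e j)‖ ^ 2 with ha
  set R : Fin 3 → ℝ := fun j => ∑ i, ∫ x, ‖fderiv ℝ (fun y => fderiv ℝ v y (e j)) x (e i)‖ ^ 2
    with hR
  set P : Fin 3 → ℝ := fun j => ∫ x, ‖fderiv ℝ v x‖ * ‖fderiv ℝ v x (e j)‖ ^ 2 with hP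
  have ha0 : ∀ j, 0 ≤ a j := fun j => integral_nonneg fun x => sq_nonneg _
  have hR0 : ∀ j, 0 ≤ R j := fun j => Finset.sum_nonneg fun i _ => integral_nonneg fun x => sq_nonneg _
  -- `Σⱼ aⱼ = ∫ |∇v|²_F`, `Σⱼ Rⱼ = ∫ ‖Δv‖²`
  have hsum_a : ∑ j, a j = ∫ x, FluidPDE.frobeniusNormSq (fderiv ℝ v x) := by
    rw [ha, ← integral_finsetSum _ fun j _ => i_a j]
    refine integral_congr_ae (Eventually.of_forall fun x => ?_)
    simp only
    rw [FluidPDE.frobeniusNormSq_eq_sum e]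
  have hHess : ∑ j, R j = ∫ x, ‖(Δ v) x‖ ^ 2 :=
    sum_sum_integral_sq_norm_fderiv_fderiv_eq_integral_sq_norm_laplacian hv hv1 hv2 hv3
  -- Step 1: `∫ Σᵢ ⟪∂ᵢv, ∂ᵢW⟫ = -∫ ⟪Δv, W⟫`
  have hL := integral_sum_inner_fderiv_fderiv_eq_neg_integral_inner_laplacian hv2' hW i1 i2 i3
  -- Step 2: the pressure term vanishes
  have hpress : ∫ x, ⟪(Δ v) x, gradient q x⟫ = 0 := by
    have hswap : (fun x => ⟪(Δ v) x, gradient q x⟫) = fun x => ⟪gradient q x, (Δ v) x⟫ :=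
      funext fun x => real_inner_comm _ _
    rw [hswap]
    refine integral_inner_gradient_eq_zero_of_isDivFree_R3 hq hΔ1
      (isDivFree_laplacian_of_contDiff_three hv hdiv) (fun i => ?_) (fun i => ?_) (fun i => ?_)
    · refine integrable_of_norm_le_mul_of_lintegral_sq
        ((continuous_const.inner cΔ).mul (cdiq i)).aestronglyMeasurable c3D2 (cdiq i) l2Δ (l2diq i)
        fun x => ?_
      rw [norm_mul]
      exact mul_le_mul ((hin i _).trans (n_Δ x)) le_rfl (norm_nonneg _) (norm_nonneg _)
    · refine integrable_of_norm_le_mul_of_lintegral_sq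
        ((continuous_const.inner (cdΔ i)).mul cq).aestronglyMeasurable c3D3 cq l2dΔ hq0
        fun x => ?_
      rw [norm_mul]
      exact mul_le_mul ((hin i _).trans (n_dΔ i x)) le_rfl (norm_nonneg _) (norm_nonneg _)
    · refine integrable_of_norm_le_mul_of_lintegral_sq
        ((continuous_const.inner cΔ).mul cq).aestronglyMeasurable c3D2 cq l2Δ hq0
        fun x => ?_
      rw [norm_mul]
      exact mul_le_mul ((hin i _).trans (n_Δ x)) le_rfl (norm_nonneg _) (norm_nonneg _)
  -- Step 3: the pointwise identity `-⟪Δv, W⟫ = -ν‖Δv‖² + ⟪Δv, (v·∇)v⟫ + ⟪Δv, ∇q⟫`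
  have hpt : ∀ x, -⟪(Δ v) x, W x⟫ =
      -ν * ‖(Δ v) x‖ ^ 2 + ⟪(Δ v) x, FluidPDE.convect v v x⟫ + ⟪(Δ v) x, gradient q x⟫ := by
    intro x
    have hWx : W x = ν • (Δ v) x - FluidPDE.convect v v x - gradient q x := by
      have h : W x = ν • (Δ v) x - gradient q x - FluidPDE.convect v v x :=
        eq_sub_iff_add_eq.2 (hmom x)
      rw [h]; abel
    rw [hWx, inner_sub_right, inner_sub_right, inner_smul_right, real_inner_self_eq_norm_sq]
    ring
  -- Step 4: integrate
  have iA : Integrable (fun x => -ν * ‖(Δ v) x‖ ^ 2) volume := iΔΔ.const_mul _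
  have iAB : Integrable (fun x => -ν * ‖(Δ v) x‖ ^ 2 + ⟪(Δ v) x, FluidPDE.convect v v x⟫) volume :=
    iA.add iΔc
  have hint : ∫ x, -⟪(Δ v) x, W x⟫ =
      -ν * (∫ x, ‖(Δ v) x‖ ^ 2) + (∫ x, ⟪(Δ v) x, FluidPDE.convect v v x⟫) +
        ∫ x, ⟪(Δ v) x, gradient q x⟫ := by
    rw [integral_congr_ae (Eventually.of_forall hpt), integral_add iAB iΔg, integral_add iA iΔc,
      integral_const_mul]
  have hneg_int : ∫ x, -⟪(Δ v) x, W x⟫ = - ∫ x, ⟪(Δ v) x, W x⟫ := integral_neg _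
  -- Step 5: the trilinear term
  have htri : ∫ x, ⟪(Δ v) x, FluidPDE.convect v v x⟫ ≤ ∑ j, P j := by
    rw [integral_inner_laplacian_convect_eq_neg_sum hv hdiv hB hB₁ hv1 hv2, ← Finset.sum_neg_distrib]
    refine Finset.sum_le_sum fun j _ => ?_
    rw [← integral_neg]
    refine integral_mono (i_Tj j).neg (i_Pj j) fun x => ?_
    simp only
    have h1 : ‖⟪fderiv ℝ v x (e j), fderiv ℝ v x (fderiv ℝ v x (e j))⟫‖ ≤
        ‖fderiv ℝ v x‖ * ‖fderiv ℝ v x (e j)‖ ^ 2 := by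
      calc ‖⟪fderiv ℝ v x (e j), fderiv ℝ v x (fderiv ℝ v x (e j))⟫‖
          ≤ ‖fderiv ℝ v x (e j)‖ * ‖fderiv ℝ v x (fderiv ℝ v x (e j))‖ := norm_inner_le_norm _ _
        _ ≤ ‖fderiv ℝ v x (e j)‖ * (‖fderiv ℝ v x‖ * ‖fderiv ℝ v x (e j)‖) :=
            mul_le_mul_of_nonneg_left ((fderiv ℝ v x).le_opNorm _) (norm_nonneg _)
        _ = ‖fderiv ℝ v x‖ * ‖fderiv ℝ v x (e j)‖ ^ 2 := by ring
    rw [Real.norm_eq_abs] at h1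
    linarith [neg_abs_le ⟪fderiv ℝ v x (e j), fderiv ℝ v x (fderiv ℝ v x (e j))⟫]
  -- Step 6: the Beirão da Veiga bound on `Σⱼ Pⱼ`
  set C : ℝ := θ * (2 * (1 - θ)) ^ ((1 - θ) / θ) * (K : ℝ) ^ (2 * (1 - θ) / θ) with hC
  have hθρ : θ = 1 - 3 / (2 * r.toReal) := hθ
  have hstep : ∀ j, P j ≤ ν / 2 * R j + C * ν ^ (1 - 1 / θ) * N ^ (1 / θ) * a j := by
    intro j
    have hkj := integral_norm_fderiv_mul_sq_norm_fderiv_apply_le hv hv1 hv2 hB₁ hr hrtop hvr j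
    rw [← hθρ, show 3 / (2 * r.toReal) = 1 - θ by rw [hθρ]; ring] at hkj
    have habs := bdv_absorb_component hθ0 hθ1 hν hN0 K.coe_nonneg (ha0 j) (hR0 j) hkj
    rw [bdv_const_identity hθ0 hN0 K.coe_nonneg] at habs
    rw [hC]
    exact habs
  have hkey : ∑ j, P j ≤ ν / 2 * ∑ j, R j + C * ν ^ (1 - 1 / θ) * N ^ (1 / θ) * ∑ j, a j := by
    calc ∑ j, P j ≤ ∑ j, (ν / 2 * R j + C * ν ^ (1 - 1 / θ) * N ^ (1 / θ) * a j) :=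
          Finset.sum_le_sum fun j _ => hstep j
      _ = ν / 2 * ∑ j, R j + C * ν ^ (1 - 1 / θ) * N ^ (1 / θ) * ∑ j, a j := by
          rw [Finset.sum_add_distrib, ← Finset.mul_sum, ← Finset.mul_sum]
  -- Step 7: conclude
  rw [hHess, hsum_a] at hkey
  rw [hL, ← hneg_int, hint, hpress, add_zero]
  have hL2 : 0 ≤ ∫ x, ‖(Δ v) x‖ ^ 2 := integral_nonneg fun x => sq_nonneg _
  nlinarith [htri, hkey, hL2, hν]

end Slice

/-! ### Grönwall on a slab of Tao's class -/

section Slab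

/-- **Beirão da Veiga's enstrophy inequality on a slab** (Beirão da Veiga 1995; Berselli–Galdi
2002, (1.3); the computation of Lemarié-Rieusset 2016, Thm. 11.2, with the trilinear term
estimated by `‖∇u‖_{L^r}`, followed by Grönwall's lemma). Let `(u, p)` be a classical solution of
the unforced Navier–Stokes system with viscosity `ν > 0` on the closed slab `[0, T] × ℝ³` in Tao's
`L²`-Sobolev class (`u`, `∂ₜu`, `p` with all `L²` Sobolev norms bounded on `[0, T]`). Let
`3/2 < r < ∞`, `θ = 1 - 3/(2 r.toReal)` (so `q = 1/θ = 2r/(2r-3)`, `2/q + 3/r = 2`), and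
`0 < s ≤ T` with `∇u(t) ∈ L^r` for a.e. `t ∈ (0, s)` and `A = ∫₀ˢ ‖∇u(t)‖_{L^r}^q dt < ∞` (lower
integral of `ofReal ((eLpNorm (∇u t) r).toReal ^ q)`). Then
`∫ |∇u(s)|² ≤ exp (2 C(θ) ν^{1-q} A) ∫ |∇u(0)|²`, `C(θ) = θ (2(1-θ))^{(1-θ)/θ} K^{2(1-θ)/θ}`.
Proof: the balance `IsSmoothSpaceTimeOn.enstrophy_balance`, the slice bound
`integral_sum_inner_fderiv_le_of_momentum_of_gradient_eLpNorm` at a.e. interior time, and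
Grönwall's lemma `lintegral_gronwall_le`. [cite: BerselliGaldi2002, (1.3) p. 3586]
[cite: LemarieRieusset2016, §11.5 p. 329 (PDF p. 353)] -/
theorem bdv_enstrophy_le_mul_exp {ν T : ℝ} (hν : 0 < ν) (hT : 0 < T)
    {u : ℝ → EuclideanSpace ℝ (Fin 3) → EuclideanSpace ℝ (Fin 3)}
    {p : ℝ → EuclideanSpace ℝ (Fin 3) → ℝ} (hsol : FluidPDE.IsClassicalNSSolutionOn (Icc 0 T) ν 0 u p)
    (hu : HasBoundedSobolevNormsOn (Icc 0 T) u)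
    (hut : HasBoundedSobolevNormsOn (Icc 0 T) (FluidPDE.timeDerivWithin (Icc 0 T) u))
    (hp : ∀ n : ℕ, ∃ C : ℝ≥0, ∀ t ∈ Icc 0 T, ∫⁻ x, ‖iteratedFDeriv ℝ n (p t) x‖ₑ ^ 2 ≤ C)
    {r : ℝ≥0∞} (hr : 3 / 2 < r) (hrtop : r ≠ ⊤) {θ : ℝ} (hθ : θ = 1 - 3 / (2 * r.toReal))
    {s : ℝ} (hs : s ∈ Ioc 0 T)
    (hLr : ∀ᵐ t ∂volume, t ∈ Ioo 0 s → eLpNorm (fderiv ℝ (u t)) r volume < ⊤)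
    (hA : ∫⁻ t in Ioo 0 s, ENNReal.ofReal ((eLpNorm (fderiv ℝ (u t)) r volume).toReal ^ (1 / θ)) ≠ ⊤) :
    ∫⁻ x, ENNReal.ofReal (FluidPDE.frobeniusNormSq (fderiv ℝ (u s) x)) ≤
      ENNReal.ofReal (Real.exp (2 * (θ * (2 * (1 - θ)) ^ ((1 - θ) / θ) *
          (SNormLESNormFDerivOfEqConst (EuclideanSpace ℝ (Fin 3))
            (volume : Measure (EuclideanSpace ℝ (Fin 3))) 2 : ℝ) ^ (2 * (1 - θ) / θ)) *
          ν ^ (1 - 1 / θ) *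
          (∫⁻ t in Ioo 0 s, ENNReal.ofReal
            ((eLpNorm (fderiv ℝ (u t)) r volume).toReal ^ (1 / θ))).toReal)) *
        ∫⁻ x, ENNReal.ofReal (FluidPDE.frobeniusNormSq (fderiv ℝ (u 0) x)) := by
  set e := EuclideanSpace.basisFun (Fin 3) ℝ with he
  set K : ℝ≥0 := SNormLESNormFDerivOfEqConst (EuclideanSpace ℝ (Fin 3))
    (volume : Measure (EuclideanSpace ℝ (Fin 3))) 2 with hK
  set C : ℝ := θ * (2 * (1 - θ)) ^ ((1 - θ) / θ) * (K : ℝ) ^ (2 * (1 - θ) / θ) with hC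
  have hU : UniqueDiffOn ℝ (Icc 0 T) := uniqueDiffOn_Icc hT
  set W : ℝ → EuclideanSpace ℝ (Fin 3) → EuclideanSpace ℝ (Fin 3) :=
    FluidPDE.timeDerivWithin (Icc 0 T) u with hW
  have hWsm : FluidPDE.IsSmoothSpaceTimeOn (Icc 0 T) W := hsol.smooth_velocity.timeDerivWithin hU
  -- the exponent
  have hr0 : r ≠ 0 := (lt_trans (by norm_num) hr).ne'
  have hρ3 : 3 / 2 < r.toReal := by
    have h : ((3 / 2 : ℝ≥0∞)).toReal < r.toReal :=
      (ENNReal.toReal_lt_toReal (ENNReal.div_ne_top (by norm_num) (by norm_num)) hrtop).2 hr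
    have h32 : ((3 / 2 : ℝ≥0∞)).toReal = 3 / 2 := by
      rw [ENNReal.toReal_div, ENNReal.toReal_ofNat, ENNReal.toReal_ofNat]
    rw [h32] at h
    exact h
  have hρ0 : 0 < r.toReal := by linarith
  have hθ0 : 0 < θ := by
    rw [hθ, sub_pos, div_lt_one (by positivity)]; linarith
  have hθ1 : θ < 1 := by
    rw [hθ]; linarith [div_pos (zero_lt_three' ℝ) (by positivity : (0 : ℝ) < 2 * r.toReal)]
  have hC0 : 0 ≤ C := by
    have : 0 ≤ 1 - θ := by linarith
    positivity
  -- pointwise bounds on `u` and `Du` over the slab (Sobolev)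
  obtain ⟨B₀, hB₀⟩ := linfty_bound_of_hasBoundedSobolevNormsOn_holds
    (fun t ht => (hsol.contDiff_velocity ht).of_le (by norm_cast)) hu
  obtain ⟨B₁, -, hB₁⟩ := exists_forall_norm_fderiv_le_of_hasBoundedSobolevNormsOn
    (fun t ht => (hsol.contDiff_velocity ht).of_le (by norm_cast)) hu
  obtain ⟨C₁, hC₁⟩ := hu 1
  obtain ⟨D₂, hD₂⟩ := hu 2
  obtain ⟨D₃, hD₃⟩ := hu 3
  obtain ⟨E₀, hE₀⟩ := hut 0
  obtain ⟨E₁, hE₁⟩ := hut 1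
  obtain ⟨P₀, hP₀⟩ := hp 0
  obtain ⟨P₁, hP₁⟩ := hp 1
  have hzero : ∀ {f : EuclideanSpace ℝ (Fin 3) → EuclideanSpace ℝ (Fin 3)} {C' : ℝ≥0},
      (∫⁻ x, ‖iteratedFDeriv ℝ 0 f x‖ₑ ^ 2 ≤ C') → ∫⁻ x, ‖f x‖ₑ ^ 2 < ⊤ := by
    intro f C' h
    refine lt_of_le_of_lt ((le_of_eq (lintegral_congr fun x => ?_)).trans h) ENNReal.coe_lt_top
    rw [← ofReal_norm, ← ofReal_norm, norm_iteratedFDeriv_zero]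
  have hzero' : ∀ {f : EuclideanSpace ℝ (Fin 3) → ℝ} {C' : ℝ≥0},
      (∫⁻ x, ‖iteratedFDeriv ℝ 0 f x‖ₑ ^ 2 ≤ C') → ∫⁻ x, ‖f x‖ₑ ^ 2 < ⊤ := by
    intro f C' h
    refine lt_of_le_of_lt ((le_of_eq (lintegral_congr fun x => ?_)).trans h) ENNReal.coe_lt_top
    rw [← ofReal_norm, ← ofReal_norm, norm_iteratedFDeriv_zero]
  -- the enstrophy balance
  obtain ⟨hΦint, hGcont, hGb⟩ := hsol.smooth_velocity.enstrophy_balance hT hC₁ hE₁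
  set Φ : ℝ → ℝ := fun t => ∫ x, 2 * ∑ i, ⟪fderiv ℝ (u t) x (e i), fderiv ℝ (W t) x (e i)⟫ with hΦ
  set G : ℝ → ℝ := fun t => ∫ x, FluidPDE.frobeniusNormSq (fderiv ℝ (u t) x) with hG
  have hG0 : ∀ t, 0 ≤ G t := fun t => integral_nonneg fun x => FluidPDE.frobeniusNormSq_nonneg _
  have hfrob_le : ∀ t ∈ Icc 0 T,
      ∫⁻ x, ENNReal.ofReal (FluidPDE.frobeniusNormSq (fderiv ℝ (u t) x)) ≤ 3 * C₁ := by
    intro t ht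
    calc ∫⁻ x, ENNReal.ofReal (FluidPDE.frobeniusNormSq (fderiv ℝ (u t) x))
        ≤ ∫⁻ x, 3 * ‖iteratedFDeriv ℝ 1 (u t) x‖ₑ ^ 2 := lintegral_mono fun x => by
          rw [← ofReal_norm, norm_iteratedFDeriv_one, ofReal_norm]
          exact ofReal_frobeniusNormSq_le_three_mul_enorm_sq _
      _ = 3 * ∫⁻ x, ‖iteratedFDeriv ℝ 1 (u t) x‖ₑ ^ 2 := lintegral_const_mul' _ _ (by norm_num)
      _ ≤ 3 * C₁ := by gcongr; exact hC₁ t ht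
  have hfrob_lt : ∀ t ∈ Icc 0 T,
      ∫⁻ x, ENNReal.ofReal (FluidPDE.frobeniusNormSq (fderiv ℝ (u t) x)) < ⊤ := fun t ht =>
    lt_of_le_of_lt (hfrob_le t ht) (ENNReal.mul_lt_top (by norm_num) ENNReal.coe_lt_top)
  have ifrob : ∀ t ∈ Icc 0 T, Integrable (fun x => FluidPDE.frobeniusNormSq (fderiv ℝ (u t) x)) volume :=
    fun t ht => integrable_of_continuous_of_nonneg
      (FluidPDE.continuous_frobeniusNormSq_fderiv (hsol.contDiff_velocity ht) (by simp))
      (fun x => FluidPDE.frobeniusNormSq_nonneg _) (hfrob_lt t ht)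
  have hGeq : ∀ t ∈ Icc 0 T, ENNReal.ofReal (G t) =
      ∫⁻ x, ENNReal.ofReal (FluidPDE.frobeniusNormSq (fderiv ℝ (u t) x)) := fun t ht =>
    ofReal_integral_eq_lintegral_ofReal (ifrob t ht)
      (Eventually.of_forall fun x => FluidPDE.frobeniusNormSq_nonneg _)
  -- the production bound at a.e. interior time: `Φ t ≤ κ t * G t`
  set Nq : ℝ → ℝ := fun t => (eLpNorm (fderiv ℝ (u t)) r volume).toReal ^ (1 / θ) with hNq
  have hNq0 : ∀ t, 0 ≤ Nq t := fun t => Real.rpow_nonneg ENNReal.toReal_nonneg _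
  have hslice : ∀ t ∈ Ioo 0 T, eLpNorm (fderiv ℝ (u t)) r volume < ⊤ →
      Φ t ≤ 2 * C * ν ^ (1 - 1 / θ) * Nq t * G t := by
    intro t ht hLrt
    have htI : t ∈ Icc 0 T := Ioo_subset_Icc_self ht
    have hmom : ∀ x, W t x + FluidPDE.convect (u t) (u t) x = ν • (Δ (u t)) x - gradient (p t) x := by
      intro x
      have h := hsol.momentum t htI x
      simpa [hW] using h
    have hsl := integral_sum_inner_fderiv_le_of_momentum_of_gradient_eLpNorm hν
      ((hsol.contDiff_velocity htI).of_le (by norm_cast))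
      ((hWsm.contDiff_slice htI).of_le (by norm_cast))
      ((hsol.contDiff_pressure htI).of_le (by norm_cast)) hmom (hsol.divFree t htI)
      (fun x => hB₀ t htI x) (fun x => hB₁ t htI x) hr hrtop hLrt hθ
      ((hC₁ t htI).trans_lt ENNReal.coe_lt_top) ((hD₂ t htI).trans_lt ENNReal.coe_lt_top)
      ((hD₃ t htI).trans_lt ENNReal.coe_lt_top)
      (hzero (hE₀ t htI)) ((hE₁ t htI).trans_lt ENNReal.coe_lt_top)
      (hzero' (hP₀ t htI)) ((hP₁ t htI).trans_lt ENNReal.coe_lt_top)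
    have h2 : Φ t = 2 * ∫ x, ∑ i, ⟪fderiv ℝ (u t) x (e i), fderiv ℝ (W t) x (e i)⟫ := by
      rw [hΦ]
      exact integral_const_mul _ _
    rw [h2]
    have := mul_le_mul_of_nonneg_left hsl (zero_le_two (α := ℝ))
    refine this.trans_eq ?_
    simp only [hC, hNq, hG, hK]
    ring
  -- Grönwall in `ℝ≥0∞`
  set φE : ℝ → ℝ≥0∞ := fun t => ENNReal.ofReal (G t) with hφE
  set κ : ℝ := 2 * C * ν ^ (1 - 1 / θ) with hκ
  have hκ0 : 0 ≤ κ := by positivity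
  set aE : ℝ → ℝ≥0∞ := fun t => ENNReal.ofReal κ * ENNReal.ofReal (Nq t) with haE
  have hM : ∀ t ∈ Icc 0 s, φE t ≤ 3 * C₁ := fun t ht => by
    rw [hφE]; simp only; rw [hGeq t ⟨ht.1, ht.2.trans hs.2⟩]
    exact hfrob_le t ⟨ht.1, ht.2.trans hs.2⟩
  have haS : ∫⁻ t in Ioo 0 s, aE t ≠ ⊤ := by
    rw [haE]; simp only
    rw [lintegral_const_mul' _ _ ENNReal.ofReal_ne_top]
    exact ENNReal.mul_ne_top ENNReal.ofReal_ne_top hA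
  -- the a.e. pointwise comparison `ofReal (Φ τ) ≤ aE τ * φE τ` on `(0, s)`
  have hcmp : ∀ᵐ τ ∂volume, τ ∈ Ioo 0 s → ENNReal.ofReal (Φ τ) ≤ aE τ * φE τ := by
    filter_upwards [hLr] with τ hτ hτs
    have hτT : τ ∈ Ioo 0 T := ⟨hτs.1, hτs.2.trans_le hs.2⟩
    calc ENNReal.ofReal (Φ τ) ≤ ENNReal.ofReal (κ * Nq τ * G τ) :=
          ENNReal.ofReal_le_ofReal (by simpa [hκ, mul_assoc] using hslice τ hτT (hτ hτs))
      _ = aE τ * φE τ := by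
          rw [haE, hφE]; simp only
          rw [ENNReal.ofReal_mul (mul_nonneg hκ0 (hNq0 τ)), ENNReal.ofReal_mul hκ0]
  have hineq : ∀ t ∈ Icc 0 s, φE t ≤ φE 0 + ∫⁻ τ in Ioo 0 t, aE τ * φE τ := by
    intro t ht
    rcases eq_or_lt_of_le ht.1 with h0 | ht0
    · rw [← h0]; simp
    have htT : t ∈ Ioc 0 T := ⟨ht0, ht.2.trans hs.2⟩
    -- `ofReal (∫ Φ) ≤ ∫⁻ ofReal Φ ≤ ∫⁻ a φ`
    have hΦt : IntegrableOn Φ (Ioo 0 t) volume := hΦint.mono_set (Ioo_subset_Ioo le_rfl htT.2)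
    have h1 : ENNReal.ofReal (∫ τ in Ioo 0 t, Φ τ) ≤ ∫⁻ τ in Ioo 0 t, ENNReal.ofReal (Φ τ) := by
      calc ENNReal.ofReal (∫ τ in Ioo 0 t, Φ τ) ≤ ENNReal.ofReal (∫ τ in Ioo 0 t, max (Φ τ) 0) :=
            ENNReal.ofReal_le_ofReal (integral_mono hΦt hΦt.pos_part fun τ => le_max_left _ _)
        _ = ∫⁻ τ in Ioo 0 t, ENNReal.ofReal (max (Φ τ) 0) :=
            ofReal_integral_eq_lintegral_ofReal hΦt.pos_part (Eventually.of_forall fun τ => le_max_right _ _)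
        _ = ∫⁻ τ in Ioo 0 t, ENNReal.ofReal (Φ τ) := lintegral_congr fun τ => by
            rcases le_total (Φ τ) 0 with h | h
            · rw [max_eq_right h, ENNReal.ofReal_zero, ENNReal.ofReal_of_nonpos h]
            · rw [max_eq_left h]
    have h2 : ∫⁻ τ in Ioo 0 t, ENNReal.ofReal (Φ τ) ≤ ∫⁻ τ in Ioo 0 t, aE τ * φE τ := by
      refine lintegral_mono_ae ((ae_restrict_iff' measurableSet_Ioo).2 ?_)
      filter_upwards [hcmp] with τ hτ hτt
      exact hτ ⟨hτt.1, hτt.2.trans_le ht.2⟩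
    calc φE t = ENNReal.ofReal (G 0 + ∫ τ in (0 : ℝ)..t, Φ τ) := by
          rw [hφE]; simp only; congr 1; exact hGb t htT
      _ ≤ ENNReal.ofReal (G 0) + ENNReal.ofReal (∫ τ in (0 : ℝ)..t, Φ τ) := ENNReal.ofReal_add_le
      _ = φE 0 + ENNReal.ofReal (∫ τ in Ioo 0 t, Φ τ) := by
          rw [intervalIntegral.integral_of_le ht.1, integral_Ioc_eq_integral_Ioo]
      _ ≤ φE 0 + ∫⁻ τ in Ioo 0 t, aE τ * φE τ := by gcongr; exact h1.trans h2
  have hgron := lintegral_gronwall_le (S := s) ENNReal.ofReal_ne_top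
    (ENNReal.mul_ne_top (by norm_num) ENNReal.coe_ne_top) hM haS hineq s ⟨hs.1.le, le_rfl⟩
  -- unpack
  have hint_a : (∫⁻ τ in Ioo 0 s, aE τ).toReal =
      κ * (∫⁻ t in Ioo 0 s, ENNReal.ofReal (Nq t)).toReal := by
    rw [haE]; simp only
    rw [lintegral_const_mul' _ _ ENNReal.ofReal_ne_top, ENNReal.toReal_mul, ENNReal.toReal_ofReal hκ0]
  rw [hint_a] at hgron
  rw [← hGeq s ⟨hs.1.le, hs.2⟩, ← hGeq 0 ⟨le_rfl, hT.le⟩, mul_comm]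
  convert hgron using 3

/-- **Beirão da Veiga's enstrophy inequality, packaged**: for every `3/2 < r < ∞` there is a
constant `C ≥ 0` (depending only on `r`) such that for every classical solution of the unforced
Navier–Stokes system on a closed slab `[0, T] × ℝ³` in Tao's `L²`-Sobolev class and every
`0 < s ≤ T` with `∇u(t) ∈ L^r` for a.e. `t ∈ (0, s)` and `A = ∫₀ˢ ‖∇u(t)‖_{L^r}^q dt < ∞`,
`q = 1/(1 - 3/(2 r.toReal))` (`2/q + 3/r = 2`), `∫ |∇u(s)|² ≤ exp (C ν^{1-q} A) ∫ |∇u(0)|²`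
(Beirão da Veiga 1995; Berselli–Galdi 2002, (1.3)). [cite: BerselliGaldi2002, (1.3) p. 3586] -/
theorem bdv_enstrophy_bound {r : ℝ≥0∞} (hr : 3 / 2 < r) (hrtop : r ≠ ⊤) :
    ∃ C : ℝ, 0 ≤ C ∧ ∀ {ν T : ℝ} (_ : 0 < ν) (_ : 0 < T)
      {u : ℝ → EuclideanSpace ℝ (Fin 3) → EuclideanSpace ℝ (Fin 3)}
      {p : ℝ → EuclideanSpace ℝ (Fin 3) → ℝ} (_ : FluidPDE.IsClassicalNSSolutionOn (Icc 0 T) ν 0 u p)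
      (_ : HasBoundedSobolevNormsOn (Icc 0 T) u)
      (_ : HasBoundedSobolevNormsOn (Icc 0 T) (FluidPDE.timeDerivWithin (Icc 0 T) u))
      (_ : ∀ n : ℕ, ∃ C' : ℝ≥0, ∀ t ∈ Icc 0 T, ∫⁻ x, ‖iteratedFDeriv ℝ n (p t) x‖ₑ ^ 2 ≤ C')
      {s : ℝ} (_ : s ∈ Ioc 0 T)
      (_ : ∀ᵐ t ∂volume, t ∈ Ioo 0 s → eLpNorm (fderiv ℝ (u t)) r volume < ⊤)
      (_ : ∫⁻ t in Ioo 0 s, ENNReal.ofReal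
        ((eLpNorm (fderiv ℝ (u t)) r volume).toReal ^ (1 / (1 - 3 / (2 * r.toReal)))) ≠ ⊤),
      ∫⁻ x, ENNReal.ofReal (FluidPDE.frobeniusNormSq (fderiv ℝ (u s) x)) ≤
        ENNReal.ofReal (Real.exp (C * ν ^ (1 - 1 / (1 - 3 / (2 * r.toReal))) *
            (∫⁻ t in Ioo 0 s, ENNReal.ofReal
              ((eLpNorm (fderiv ℝ (u t)) r volume).toReal ^ (1 / (1 - 3 / (2 * r.toReal))))).toReal)) *
          ∫⁻ x, ENNReal.ofReal (FluidPDE.frobeniusNormSq (fderiv ℝ (u 0) x)) := by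
  set θ : ℝ := 1 - 3 / (2 * r.toReal) with hθ
  set K : ℝ≥0 := SNormLESNormFDerivOfEqConst (EuclideanSpace ℝ (Fin 3))
    (volume : Measure (EuclideanSpace ℝ (Fin 3))) 2 with hK
  -- `0 < θ < 1`
  have hr0 : r ≠ 0 := (lt_trans (by norm_num) hr).ne'
  have hρ3 : 3 / 2 < r.toReal := by
    have h : ((3 / 2 : ℝ≥0∞)).toReal < r.toReal :=
      (ENNReal.toReal_lt_toReal (ENNReal.div_ne_top (by norm_num) (by norm_num)) hrtop).2 hr
    have h32 : ((3 / 2 : ℝ≥0∞)).toReal = 3 / 2 := by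
      rw [ENNReal.toReal_div, ENNReal.toReal_ofNat, ENNReal.toReal_ofNat]
    rw [h32] at h
    exact h
  have hρ0 : 0 < r.toReal := by linarith
  have hθ0 : 0 < θ := by
    rw [hθ, sub_pos, div_lt_one (by positivity)]; linarith
  have hθ1 : 0 ≤ 1 - θ := by
    rw [hθ]; linarith [div_pos (zero_lt_three' ℝ) (by positivity : (0 : ℝ) < 2 * r.toReal)]
  refine ⟨2 * (θ * (2 * (1 - θ)) ^ ((1 - θ) / θ) * (K : ℝ) ^ (2 * (1 - θ) / θ)), by positivity, ?_⟩
  intro ν T hν hT u p hsol hu hut hp s hs hLr hA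
  have h := bdv_enstrophy_le_mul_exp hν hT hsol hu hut hp hr hrtop hθ hs hLr hA
  simpa only [mul_assoc] using h

end Slab

end Literature.Analysis.FluidPDE

end
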